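import Mathlib
import Literature.NumberTheory.LFunctions.Zhang2022.SkeletonPartOne
import Literature.NumberTheory.LFunctions.Zhang2022.SkeletonAssembly
import Literature.NumberTheory.LFunctions.Zhang2022.TypedSection01and02B
import Literature.NumberTheory.LFunctions.Zhang2022.Section4Statements
import Literature.NumberTheory.LFunctions.Zhang2022.Section4RoucheCircle
import Literature.NumberTheory.LFunctions.Zhang2022.Section4Lemma45
import Literature.NumberTheory.LFunctions.Zhang2022.Section4CalBCriticalLine
import Literature.NumberTheory.LFunctions.Zhang2022.Section5VerticalShift
import Literature.NumberTheory.LFunctions.DirichletLFunctionZeroReflection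
import HarnessLib

/-!
# Zhang (2022), §4 typed statements C: Lemmas 4.5–4.8 and every display of their proofs
# (Z22 pp. 21–23, tex L1153–L1288) — Case 1/Case 2 of Lemma 4.5, (4.11), the Rouché reduction of
# Lemma 4.6, (4.12), (4.13), the polar case analysis, the gap remark, Lemma 4.7's three zeros,
# Lemma 4.8's display

Topic `Literature/NumberTheory/LFunctions/Zhang2022` (Landau–Siegel audit tree; verdict-neutral).
Y. Zhang, *Discrete mean estimates and the Landau–Siegel zero*, arXiv:2211.02515v1 (2022)
[Zhang2022LandauSiegel] — **an unrefereed manuscript under adjudication. Every `def … : Prop`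
below is a CLAIM OF THE MANUSCRIPT, STATED NOT ASSERTED** (cell siegel-zhang, D-0069 campaign,
layer L1, slice `L1-t7` = DAG nodes `Z22:Lem4.5 … Z22:§4.u060` of `plan/DAG.tsv`), typed over the
REAL objects of the banked skeleton (`Skeleton.calA = 𝒜`, `Skeleton.calB = ℬ`, `Fpoly = F(s,ψ)`,
`FpolyBar = F(s,ψ̄)`, `Gpoly = G`, `LL = L(s,ψ)L(s,ψχ)`, `tildeZW = Z̃`, `Omega`, `Omega1/2/3`,
`alpha = α`, `ell = 𝓛`, `ell1 = 𝓛₁`, `t0`, `bigP = P`, `PsiOne = Ψ₁`, `prodZeroSetOmega`), with the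
manuscript's standing quantifier `Skeleton.ForAllLarge` ("`D` sufficiently large", every real
primitive `χ (mod D)`) and its standing hypothesis "`ψ (mod p) ∈ Ψ₁`" (§4 p. 16: "This assumption
will not be repeated in the statements of Lemma 4.1-4.8"). A printed `X ≪ Y` / `X = O(Y)` is typed
`∃ C, ForAllLarge (… ‖X‖ ≤ C·Y)`, a printed `(1 + o(1))` as `∀ ε > 0, ForAllLarge (…)`.

The four numbered statements of this span are ALREADY banked skeleton nodes and are CITED, not
re-typed: `Skeleton.Lemma45`, `Skeleton.Lemma46 c′`, `Skeleton.Lemma47 c′`, `Skeleton.Lemma48`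
(`SkeletonPartOne`, p403318), as is (4.10) = `Skeleton.Eq410` and the deduction node
`Skeleton.Ded22 c′`; this file adds the regions of Lemmas 4.5/4.6 as sets with the `iff` to the
banked nodes, and one declaration per proof display / proof-intermediate claim:

| node (plan/DAG.tsv) | decl | printed item (p.) |
|---|---|---|
| `Z22:§4.u041`, `u042`, `Lem4.5` | `lemma45Region`, `lemma45_iff` | hypothesis / conclusion displays of Lemma 4.5 (p.21) |
| `Z22:§4.u043` | `Step4u043` | Case 1: `F(1−s,ψ̄)/F(s,ψ) ≪ D^c` (p.21) |
| `Z22:§4.u044` | `Step4u044` | Case 1: `ℬ(s,ψ) ≪ P^{1/2−σ}` (p.21) |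
| prose before (4.11) | `Lem45Case2MemOmega2` (+ `_holds`) | "both `σ′+it` and `1−\overline{(σ′+it)}` lie in `Ω₂`" (p.21) |
| `Z22:(4.11)` | `Eq411Identity`, `Eq411` | `ℬ′/ℬ = Z̃′/Z̃ − F′/F − F′/F(1−σ′−it,ψ̄) = −2log P + O(𝓛)` (p.21) |
| prose p.22 | `CalBNormOnLine` | "Since `|ℬ(1/2+it,ψ)| = 1`" |
| `Z22:§4.u045` | `Step4u045Eq`, `Step4u045` | `log|ℬ| = Re∫ℬ′/ℬ < (1/2−σ)log P` (p.22) |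
| `Z22:§4.u046` | `Step4u046`, `Step4u046Alpha` | `|𝒜| > 1 − P^{1/2−σ} + O(𝓛⁻¹⁰⁰) ≫ α` (p.22) |
| `Z22:Lem4.5.pf` | `DedLem45` | the proof block as a deduction |
| `Z22:§4.u047`, `Lem4.6` | `lemma46Region`, `lemma46_iff` | hypothesis display of Lemma 4.6 (p.22) |
| `Z22:Lem4.6.pf` (reduction) | `Lem46OneZero`, `LLZeroReflect` (+ `_holds`), `DedLem46` | "It suffices to show … exactly one zero … counted with multiplicity" (p.22) |
| `Z22:§4.u048` | `Step4u048`, `OneSubPwOneZero` (+ `_of_nonneg`) | Rouché inequality on `|w| = α(1−c′α𝓛)`; "`1−P^{−2w}` has exactly one zero … at `w=0`" (p.22) |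
| `Z22:(4.12)` | `Eq412` | `𝒜(1/2+iγ+w) − (1−P^{−2w}) ≪ α𝓛`, `|w| < 2α` (p.22) |
| `Z22:(4.13)` | `Eq413` (+ `eq413_of_pos`) | `|1−P^{−2w}| > 6c′α𝓛` on `|w| = α(1−c′α𝓛)` (p.22) |
| `Z22:§4.u049` | `Step4u049` | `𝒜 − (1−P^{−2w}) = ℬ + P^{−2w} + O(𝓛⁻¹⁰⁰)` (p.22) |
| prose p.22 | `Lem46SegmentMemOmega2` (+ `_holds`) | "both `s` and `1−s` [sc. `1−s̄`] are in `Ω₂`" on the segment |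
| `Z22:§4.u050` | `Step4u050Exp`, `Step4u050ExpEst`, `Step4u050` | `ℬ(1/2+iγ+w)/ℬ(ρ) = exp{∫ℬ′/ℬ} = exp{−2wlog P + O(α𝓛)} = P^{−2w} + O(α𝓛)` (p.22) |
| prose p.23 | `Lem46CalBAtZero`, `DedEq412` | "Since `ℬ(ρ) = −1 + O(𝓛⁻¹⁰⁰)` by (4.10), (4.12) follows" |
| `Z22:§4.u051`, `u052` | `wPolar`, `norm_Pm2w_wPolar`, `im_Pm2w_wPolar` | `w = α(1−c′α𝓛)(cos θ + i sin θ)`; `|P^{−2w}|`, `Im P^{−2w}` EXACT (p.23) |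
| `Z22:§4.u053`–`u055` | `Step4u053`, `Step4u054`, `Step4u055` (+ `_of_pos`) | the three cases (p.23) |
| `Z22:§4.u056`, `u057` | `Step4u056` (+ `_holds`), `Step4u057` | `√(1−(c′α𝓛)²) ≤ |sin θ| ≤ 1`; `|sin{…}| = 2πc′α𝓛(1+o(1))` (p.23) |
| prose p.23 | `Lem46Gap`, `DedProp22i_ii`, `DedProp22iii` | "gap … > α(1−c′α𝓛)"; "Lemma 4.5 and 4.6 ⇒ (i),(ii)"; "(iii) ⇐ Lemma 4.7" |
| `Z22:Lem4.7.pf`, `u058` | `Step4u058`, `OneSubPwThreeZeros` (+ `_of_pos`), `DedLem47` | Rouché on `|w| = α(1+c′α𝓛)`; zeros `0, ±iα` (p.23) |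
| `Z22:§4.u060` | `Step4u060` (+ `step4u060_of_prop22i_of_lemma44`) | `F(ρ) + Z̃(ρ)F(1−ρ,ψ̄) ≪ 𝓛⁻¹⁷⁹` (p.23) |

(`Z22:§4.u059` is the conclusion display of Lemma 4.8 = `Skeleton.Lemma48`; `Z22:Lem4.8.pf` is the
kernel edge `lemma48_of` of sz-skel's `SkeletonPartOneC`, not typed here.)

Kernel-checked here (0 new facts): the EDGES `dedLem45_holds : DedLem45`, `dedLem46_holds :
∀ c′, DedLem46 c′` (the unprinted reflection inference of Lemma 4.6 in situ), `dedEq412_holds :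
DedEq412`, `lem46CalBAtZero_of_eq410`, `step4u049_inner_of_eq410` ((4.10) reaches `Re w > −α` only —
see there), `step4u048_of_eq412` (Rouché hypothesis for `c′ > C/6`), `prop22i_of` / `prop22ii_of` /
`dedProp22i_ii_of_step4u046Alpha` (Proposition 2.2 (i), (ii) from Lemmas 4.2, 4.5, 4.6 AS STATED plus
the Case-2 display at the seam `σ = 1/2 + α²`), `lem46Gap_of` (the gap remark from (i) and Lemma 4.6
with any smaller constant); `lemma45_iff`, `lemma46_iff`; the EXACT polar
displays `norm_Pm2w_wPolar`, `im_Pm2w_wPolar` and the three case displays, (4.13) `eq413_of_pos`,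
the zero sets of `1 − P^{−2w}` (`oneSubPwOneZero_of_nonneg`, `oneSubPwThreeZeros_of_pos`) — all by
instantiating the tree's `Zhang2022.Lemma46.*` (`Section4RoucheCircle`) at `P = P(D)`,
`δ = c′α𝓛 = c′π𝓛⁻⁸ → 0`; the two region-membership remarks (`lem45Case2MemOmega2_holds`,
`lem46SegmentMemOmega2_holds`, elementary inequalities); `llZeroReflect_holds` (the unprinted reflection
step, from the tree's `DirichletLFunctionZeroReflection`); `step4u060_of_prop22i_of_lemma44` (Lemma 4.4 is
stated on `Ω₃ ⊉ Ω`; at a zero on the line, Prop. 2.2 (i), it applies — "implied in the proof of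
Proposition 2.2").
The tree's `Zhang2022.Lemma45.*` (`Section4Lemma45`) proves the STRUCTURAL form of (4.11)/u045/
u046/u050/(4.12) for arbitrary holomorphic `ℬ`, `𝒜`; the claims below are their instances for the
manuscript's `ℬ`, `𝒜`, whose inputs are claim nodes elsewhere: Lemma 4.3 = `Skeleton.Lemma43`,
(4.5)/(4.6) = `Section4.Eq45`/`Section4.Eq46` (L1-t3's `Section4Statements.lean`, p411835),
(4.10) = `Skeleton.Eq410`. Naming (plan/L1/ASSIGNMENTS.md §3): displays `Eq4nm`, un-numbered
displays `Step4uNNN` (DAG ids), lemma proof blocks `DedLem4N` (the names `Ded47`–`Ded49` are the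
deductions of displays (4.7)–(4.9) in the sibling §4 files), prose claims descriptively.

Print defects met in this span (recorded, not repaired): p.22 "`c′` is a sufficiently constant"
[sc. sufficiently large]; p.22 "both `s` and `1 − s` are in `Ω₂`" — `Im(1−s) = −t` is nowhere near
`2πt₀`, the reading under which (4.11) is invoked is `1 − s̄` (as in the hypothesis line of (4.11)
itself, "`1−\overline{(σ′+it)}` lie in `Ω₂`"), typed that way in `Lem46SegmentMemOmega2`; p.23 "In
either case (4.16) holds" — (4.16) does not exist, (4.13) is meant (LOCATORS.md audit).

## References

* Y. Zhang, arXiv:2211.02515v1 (2022), §4 pp. 21–23: Lemma 4.5 (proof, Cases 1–2, (4.11)),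
  Lemma 4.6 (proof, (4.12), (4.13)), Lemma 4.7 (proof), Lemma 4.8 (proof); (2.7) `Ω`, (2.10) `α`.
  [cite: Zhang2022LandauSiegel, §4 Lemmas 4.5–4.8 pp.21–23]
-/

noncomputable section

open Complex Real ComplexConjugate

namespace Literature.NumberTheory.LFunctions.Zhang2022.Section4

open Literature.NumberTheory.LFunctions.Zhang2022.Skeleton

/-! ## Shared objects: `P^{−2w}`, the parameter `δ = c′α𝓛`, elementary facts about `P`, `α`, `𝓛` -/

/-- `P^{−2w}` (§4 p. 22), Mathlib's complex power of the real `P = exp{𝓛⁹} > 0`; it is the tree's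
entire function `Zhang2022.Lemma46.Pw P w = exp(−2w log P)` (`Pm2w_eq_Pw`).
[cite: Zhang2022LandauSiegel, §4 Lemma 4.6 (proof) p.22] -/
def Pm2w (D : ℕ) (w : ℂ) : ℂ := (bigP D : ℂ) ^ (-(2 * w))

/-- `P = exp{𝓛⁹} > 0`. [cite: Zhang2022LandauSiegel, §2 (2.6) p.5] -/
private theorem bigP_pos (D : ℕ) : 0 < bigP D := Real.exp_pos _

/-- `P^{−2w}` is the tree's `Lemma46.Pw P w = exp(−2w log P)`.
[cite: Zhang2022LandauSiegel, §4 Lemma 4.6 (proof) p.22] -/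
theorem Pm2w_eq_Pw (D : ℕ) (w : ℂ) : Pm2w D w = Lemma46.Pw (bigP D) w :=
  (Lemma46.Pw_eq_cpow (bigP_pos D) w).symm

/-- The tree's `Lemma46.alpha P = π/log P` at `P = P(D)` is the skeleton's `α` (2.10).
[cite: Zhang2022LandauSiegel, §2 (2.10) p.6] -/
theorem treeAlpha_eq (D : ℕ) : Lemma46.alpha (bigP D) = alpha D := rfl

/-- `𝓛 = log D > 0` for `D ≥ 2`. [cite: Zhang2022LandauSiegel, §2 (2.1) p.3] -/
private theorem ell_pos {D : ℕ} (hD : 2 ≤ D) : 0 < ell D :=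
  Real.log_pos (by exact_mod_cast hD)

/-- `P > 1` for `D ≥ 2`. [cite: Zhang2022LandauSiegel, §2 (2.6) p.5] -/
private theorem one_lt_bigP {D : ℕ} (hD : 2 ≤ D) : 1 < bigP D := by
  rw [bigP]
  exact Real.one_lt_exp_iff.mpr (pow_pos (ell_pos hD) 9)

/-- `α > 0` for `D ≥ 2`. [cite: Zhang2022LandauSiegel, §2 (2.10) p.6] -/
private theorem alpha_pos {D : ℕ} (hD : 2 ≤ D) : 0 < alpha D := by
  rw [Section2.alpha_eq_pi_div_ell9]; exact div_pos Real.pi_pos (pow_pos (ell_pos hD) 9)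

/-- `α𝓛 = π𝓛⁻⁸` for `D ≥ 2` (so the proof's small parameter is `c′α𝓛 = c′π𝓛⁻⁸`).
[cite: Zhang2022LandauSiegel, §4 Lemma 4.6 (proof) p.22] -/
theorem alpha_mul_ell {D : ℕ} (hD : 2 ≤ D) : alpha D * ell D = π / ell D ^ 8 := by
  have h := (ell_pos hD).ne'
  rw [Section2.alpha_eq_pi_div_ell9]
  field_simp

/-- `α𝓛 ≥ 0` for every `D` (for `D ≤ 1`, `𝓛 = 0`). [cite: Zhang2022LandauSiegel, §2 (2.10) p.6] -/
theorem alpha_mul_ell_nonneg (D : ℕ) : 0 ≤ alpha D * ell D := by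
  have hℓ : 0 ≤ ell D := Real.log_natCast_nonneg D
  rw [Section2.alpha_eq_pi_div_ell9]
  positivity

/-- **`c′α𝓛 → 0`**: for every `c′` and `ε > 0`, `c′α𝓛 ≤ ε` for all `D ≥ D₀(c′, ε)` — the content of
"`D` sufficiently large" wherever the proof treats `c′α𝓛` as small.
[cite: Zhang2022LandauSiegel, §4 Lemma 4.6 (proof) p.22] -/
theorem exists_delta_le (c' ε : ℝ) (hε : 0 < ε) :
    ∃ D₀ : ℕ, 2 ≤ D₀ ∧ ∀ D : ℕ, D₀ ≤ D → c' * alpha D * ell D ≤ ε := by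
  rcases le_or_gt c' 0 with hc | hc
  · refine ⟨2, le_rfl, fun D _ => ?_⟩
    have := alpha_mul_ell_nonneg D
    nlinarith
  · -- `D₀ = ⌈exp(max 1 (πc′/ε))⌉₊`: then `𝓛 ≥ max 1 (πc′/ε)`, `𝓛⁸ ≥ 𝓛`, `c′π/𝓛⁸ ≤ ε`.
    set M : ℝ := max 1 (π * c' / ε) with hM
    refine ⟨max 2 ⌈Real.exp M⌉₊, le_max_left _ _, fun D hD => ?_⟩
    have hD2 : 2 ≤ D := le_trans (le_max_left _ _) hD
    have hDM : Real.exp M ≤ D := le_trans (Nat.le_ceil _) (by exact_mod_cast le_trans (le_max_right _ _) hD)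
    have hℓM : M ≤ ell D := by
      rw [ell]
      exact (Real.le_log_iff_exp_le (by positivity)).mpr hDM
    have hℓ1 : 1 ≤ ell D := le_trans (le_max_left _ _) hℓM
    have hℓ8 : ell D ≤ ell D ^ 8 := by
      calc ell D = ell D ^ 1 := (pow_one _).symm
        _ ≤ ell D ^ 8 := pow_le_pow_right₀ hℓ1 (by norm_num)
    have hpos : 0 < ell D ^ 8 := by positivity
    rw [mul_assoc, alpha_mul_ell hD2]
    have h1 : π * c' / ε ≤ ell D ^ 8 := le_trans (le_max_right _ _) (hℓM.trans hℓ8)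
    rw [div_le_iff₀ hε] at h1
    calc c' * (π / ell D ^ 8) = π * c' / ell D ^ 8 := by ring
      _ ≤ ε := by rw [div_le_iff₀ hpos]; linarith [mul_comm ε (ell D ^ 8)]

/-! ## Lemma 4.5 (p.21) — banked as `Skeleton.Lemma45`; its region, and the proof displays -/

/-- **The region of Lemma 4.5** (display `Z22:§4.u041`): "`1/2 + α² < σ < 1`, `|t − 2πt₀| < 𝓛₁ + 2`".
[Z22 p.21, tex L1154] [cite: Zhang2022LandauSiegel, Lemma 4.5 p.21] -/
def lemma45Region (D : ℕ) : Set ℂ :=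
  {s | 1 / 2 + alpha D ^ 2 < s.re ∧ s.re < 1 ∧ |s.im - 2 * π * t0 D| < ell1 D + 2}

/-- **Lemma 4.5** (displays `Z22:§4.u041`–`u042`, "then `𝒜(s,ψ) ≠ 0`") is the banked node
`Skeleton.Lemma45` (p403318); by reference, over `lemma45Region`. [Z22 p.21, tex L1153–L1158]
[cite: Zhang2022LandauSiegel, Lemma 4.5 p.21] -/
theorem lemma45_iff : Lemma45 ↔
    ForAllLarge fun D _ χ => ∀ x ∈ PsiOne χ, ∀ s ∈ lemma45Region D, calA χ x s ≠ 0 := by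
  unfold Lemma45 lemma45Region
  simp only [Set.mem_setOf_eq, and_imp]

/-- **The two cases of the proof of Lemma 4.5** (p.21): "Case 1. `1/2 + 𝓛⁻¹ ≤ σ < 1`" (with the
lemma's `|t − 2πt₀| < 𝓛₁ + 2`). [Z22 p.21, tex L1163] [cite: Zhang2022LandauSiegel, Lemma 4.5 (proof) p.21] -/
def case1Region45 (D : ℕ) : Set ℂ :=
  {s | 1 / 2 + (ell D)⁻¹ ≤ s.re ∧ s.re < 1 ∧ |s.im - 2 * π * t0 D| < ell1 D + 2}

/-- "Case 2. `1/2 + α² ≤ σ < 1/2 + 𝓛⁻¹`" (with `|t − 2πt₀| < 𝓛₁ + 2`) — CLOSED at `σ = 1/2 + α²`, as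
printed: the proof's Case 2 covers the seam point that the STATEMENTS of Lemma 4.5 (`σ > 1/2 + α²`)
and Lemma 4.6 (`β < 1/2 + α²`) both omit (print-defect list, adj-4); the Case-2 displays below are
typed over this closed range so that the seam is visibly closed by the printed proof (`prop22i_of`).
[Z22 p.21, tex L1176] [cite: Zhang2022LandauSiegel, Lemma 4.5 (proof) p.21] -/
def case2Region45 (D : ℕ) : Set ℂ :=
  {s | 1 / 2 + alpha D ^ 2 ≤ s.re ∧ s.re < 1 / 2 + (ell D)⁻¹ ∧ |s.im - 2 * π * t0 D| < ell1 D + 2}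

/-- **Proof of Lemma 4.5, Case 1** (`1/2 + 𝓛⁻¹ ≤ σ < 1`), display `Z22:§4.u043`: "By Lemma 4.2 and
trivial estimation, `F(1−s,ψ̄)/F(s,ψ) ≪ D^c`" (some constant `c`). CLAIM.
[Z22 p.21, tex L1170] [cite: Zhang2022LandauSiegel, Lemma 4.5 (proof, Case 1) p.21] -/
def Step4u043 : Prop :=
  ∃ c C : ℝ, ForAllLarge fun D _ χ => ∀ x ∈ PsiOne χ, ∀ s ∈ case1Region45 D,
    ‖FpolyBar χ x (1 - s) / Fpoly χ x s‖ ≤ C * (D : ℝ) ^ c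

/-- **Proof of Lemma 4.5, Case 1**, display `Z22:§4.u044`: "Hence, by (4.5), `ℬ(s,ψ) ≪ P^{1/2−σ}`"
("The result now follows by (4.10)"). CLAIM. [Z22 p.21, tex L1172]
[cite: Zhang2022LandauSiegel, Lemma 4.5 (proof, Case 1) p.21] -/
def Step4u044 : Prop :=
  ∃ C : ℝ, ForAllLarge fun D _ χ => ∀ x ∈ PsiOne χ, ∀ s ∈ case1Region45 D,
    ‖calB χ x s‖ ≤ C * bigP D ^ (1 / 2 - s.re)

/-- **Proof of Lemma 4.5, Case 2** (`1/2 + α² ≤ σ < 1/2 + 𝓛⁻¹`), prose before (4.11): "Assume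
`1/2 ≤ σ′ ≤ σ`. Then both `σ′ + it` and `1 − \overline{(σ′+it)}` lie in `Ω₂`." CLAIM — and TRUE
(`lem45Case2MemOmega2_holds`, elementary). [Z22 p.21, tex L1179–L1180]
[cite: Zhang2022LandauSiegel, Lemma 4.5 (proof, Case 2) p.21] -/
def Lem45Case2MemOmega2 : Prop :=
  ForAllLarge fun D _ _ => ∀ s ∈ case2Region45 D,
    ∀ σ' : ℝ, 1 / 2 ≤ σ' → σ' ≤ s.re →
      ((σ' : ℂ) + s.im * I) ∈ Omega2 D ∧ (1 - conj ((σ' : ℂ) + s.im * I)) ∈ Omega2 D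

/-- **(4.11), first line** (Case 2 of Lemma 4.5; `s = σ+it` in the Case-2 range, `1/2 ≤ σ′ ≤ σ`):
"`ℬ′/ℬ(σ′+it,ψ) = Z̃′/Z̃(σ′+it,ψ) − F′/F(σ′+it,ψ) − F′/F(1−σ′−it,ψ̄)`" — the logarithmic derivative
of `ℬ = Z̃·F(1−s,ψ̄)/F(s,ψ)`. CLAIM (structural form kernel-checked for any three factors:
tree `Zhang2022.Lemma45.logDeriv_calB`). [Z22 p.21, (4.11), tex L1182–L1184]
[cite: Zhang2022LandauSiegel, (4.11) p.21] -/
def Eq411Identity : Prop :=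
  ForAllLarge fun D _ χ => ∀ x ∈ PsiOne χ, ∀ s ∈ case2Region45 D,
    ∀ σ' : ℝ, 1 / 2 ≤ σ' → σ' ≤ s.re →
      deriv (calB χ x) ((σ' : ℂ) + s.im * I) / calB χ x ((σ' : ℂ) + s.im * I)
        = deriv (tildeZW χ x) ((σ' : ℂ) + s.im * I) / tildeZW χ x ((σ' : ℂ) + s.im * I)
          - deriv (Fpoly χ x) ((σ' : ℂ) + s.im * I) / Fpoly χ x ((σ' : ℂ) + s.im * I)
          - deriv (FpolyBar χ x) (1 - ((σ' : ℂ) + s.im * I)) / FpolyBar χ x (1 - ((σ' : ℂ) + s.im * I))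

/-- **(4.11)** (Case 2 of Lemma 4.5; "Hence, by Lemma 4.3 and (4.6)"): for `s = σ+it` with
`1/2 + α² ≤ σ < 1/2 + 𝓛⁻¹`, `|t − 2πt₀| < 𝓛₁ + 2` and `1/2 ≤ σ′ ≤ σ`,
"`ℬ′/ℬ(σ′+it,ψ) = −2log P + O(𝓛)`". CLAIM (bookkeeping kernel-checked: tree
`Zhang2022.Lemma45.norm_logDeriv_calB_le`; inputs Lemma 4.3 = `Skeleton.Lemma43`, (4.6) =
`Section4.Eq46` of L1-t3's `Section4Statements.lean`). [Z22 p.21, (4.11), tex L1182–L1186] [cite: Zhang2022LandauSiegel, (4.11) p.21] -/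
def Eq411 : Prop :=
  ∃ C : ℝ, ForAllLarge fun D _ χ => ∀ x ∈ PsiOne χ, ∀ s ∈ case2Region45 D,
    ∀ σ' : ℝ, 1 / 2 ≤ σ' → σ' ≤ s.re →
      ‖deriv (calB χ x) ((σ' : ℂ) + s.im * I) / calB χ x ((σ' : ℂ) + s.im * I)
          + 2 * Real.log (bigP D)‖ ≤ C * ell D

/-- **"Since `|ℬ(1/2+it,ψ)| = 1`"** (proof of Lemma 4.5, Case 2; `|t − 2πt₀| < 𝓛₁ + 2`): on the
critical line `|Z̃| = 1` and `|F(1/2−it,ψ̄)| = |F(1/2+it,ψ)|`. CLAIM (it needs `F(1/2+it,ψ) ≠ 0`,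
Lemma 4.2; `|Z(1/2+it,θ)| = 1` is the tree's `norm_Zfac_half_eq_one`).
[Z22 p.22, tex L1187–L1188] [cite: Zhang2022LandauSiegel, Lemma 4.5 (proof, Case 2) p.22] -/
def CalBNormOnLine : Prop :=
  ForAllLarge fun D _ χ => ∀ x ∈ PsiOne χ, ∀ t : ℝ, |t - 2 * π * t0 D| < ell1 D + 2 →
    ‖calB χ x (1 / 2 + t * I)‖ = 1

/-- **Display `Z22:§4.u045`, the identity**: (Case 2) "`log|ℬ(s,ψ)| = Re{∫_{1/2}^{σ} ℬ′/ℬ(σ′+it)dσ′}`"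
(from `|ℬ(1/2+it)| = 1`). CLAIM (structural form kernel-checked: tree
`Zhang2022.Lemma45.log_norm_eq_re_integral`, for `ℬ` analytic and zero-free on the segment).
[Z22 p.22, tex L1189–L1191] [cite: Zhang2022LandauSiegel, Lemma 4.5 (proof, Case 2) p.22] -/
def Step4u045Eq : Prop :=
  ForAllLarge fun D _ χ => ∀ x ∈ PsiOne χ, ∀ s ∈ case2Region45 D,
    Real.log ‖calB χ x s‖ =
      (∫ σ' in (1 / 2 : ℝ)..s.re,
        deriv (calB χ x) ((σ' : ℂ) + s.im * I) / calB χ x ((σ' : ℂ) + s.im * I)).re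

/-- **Display `Z22:§4.u045`, the inequality**: (Case 2) "`log|ℬ(s,ψ)| < (1/2 − σ)log P`". CLAIM
(structural form: tree `Zhang2022.Lemma45.log_norm_le_of_re_logDeriv_le`).
[Z22 p.22, tex L1189–L1191] [cite: Zhang2022LandauSiegel, Lemma 4.5 (proof, Case 2) p.22] -/
def Step4u045 : Prop :=
  ForAllLarge fun D _ χ => ∀ x ∈ PsiOne χ, ∀ s ∈ case2Region45 D,
    Real.log ‖calB χ x s‖ < (1 / 2 - s.re) * Real.log (bigP D)

/-- **Display `Z22:§4.u046`, first part**: (Case 2) "Hence, by (4.10),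
`|𝒜(s,ψ)| > 1 − P^{1/2−σ} + O(𝓛⁻¹⁰⁰)`". CLAIM (structural form: tree
`Zhang2022.Lemma45.norm_calA_ge`). [Z22 p.22, tex L1193]
[cite: Zhang2022LandauSiegel, Lemma 4.5 (proof, Case 2) p.22] -/
def Step4u046 : Prop :=
  ∃ C : ℝ, ForAllLarge fun D _ χ => ∀ x ∈ PsiOne χ, ∀ s ∈ case2Region45 D,
    1 - bigP D ^ (1 / 2 - s.re) - C * (ell D ^ 100)⁻¹ < ‖calA χ x s‖

/-- **Display `Z22:§4.u046`, second part**: (Case 2) "`|𝒜(s,ψ)| … ≫ α`" (for `σ ≥ 1/2 + α²`,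
`P^{1/2−σ} ≤ P^{−α²} = e^{−πα}`; structural form: tree `Zhang2022.Lemma45.norm_calA_ge_alpha`).
CLAIM. [Z22 p.22, tex L1193] [cite: Zhang2022LandauSiegel, Lemma 4.5 (proof, Case 2) p.22] -/
def Step4u046Alpha : Prop :=
  ∃ c : ℝ, 0 < c ∧ ForAllLarge fun D _ χ => ∀ x ∈ PsiOne χ, ∀ s ∈ case2Region45 D,
    c * alpha D ≤ ‖calA χ x s‖

/-- **The proof block of Lemma 4.5** (`Z22:Lem4.5.pf`) as a deduction: Case 1 ("`ℬ ≪ P^{1/2−σ}`. The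
result now follows by (4.10)") and Case 2 ("`|𝒜| ≫ α`") give Lemma 4.5. CLAIM (the deduction; the
Case-1 half needs `C·P^{−𝓛⁻¹} + C′𝓛⁻¹⁰⁰ < 1`, `P^{−1/𝓛} = exp(−𝓛⁸)`).
[Z22 pp.21–22, tex L1160–L1194] [cite: Zhang2022LandauSiegel, Lemma 4.5 (proof) pp.21–22] -/
def DedLem45 : Prop := Eq410 → Step4u044 → Step4u046Alpha → Lemma45

/-! ## Lemma 4.6 (p.22) — banked as `Skeleton.Lemma46 c′`; its region, the reduction, (4.12), (4.13) -/

/-- **The hypothesis region of Lemma 4.6** (display `Z22:§4.u047`): zeros `ρ = β + iγ` of `𝒜(s,ψ)`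
with "`1/2 ≤ β < 1/2 + α²`, `|γ − 2πt₀| < 𝓛₁ + 2`". [Z22 p.22, tex L1198]
[cite: Zhang2022LandauSiegel, Lemma 4.6 p.22] -/
def lemma46Region (D : ℕ) : Set ℂ :=
  {ρ | 1 / 2 ≤ ρ.re ∧ ρ.re < 1 / 2 + alpha D ^ 2 ∧ |ρ.im - 2 * π * t0 D| < ell1 D + 2}

variable (c' : ℝ)

/-- **Lemma 4.6** ("Then `β = 1/2`, `𝒜′(ρ,ψ) ≠ 0` and `𝒜(1/2+iγ+w,ψ) ≠ 0` if `0 < |w| < α(1−c′α𝓛)`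
where `c′` is a sufficiently [large] constant") is the banked node `Skeleton.Lemma46 c′` (p403318);
by reference, over `lemma46Region`. [Z22 p.22, tex L1197–L1202]
[cite: Zhang2022LandauSiegel, Lemma 4.6 p.22] -/
theorem lemma46_iff : Lemma46 c' ↔
    ForAllLarge fun D _ χ => ∀ x ∈ PsiOne χ, ∀ ρ : ℂ, calA χ x ρ = 0 → ρ ∈ lemma46Region D →
      ρ.re = 1 / 2 ∧ deriv (calA χ x) ρ ≠ 0 ∧
        ∀ w : ℂ, 0 < ‖w‖ → ‖w‖ < alpha D * (1 - c' * alpha D * ell D) →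
          calA χ x (ρ + w) ≠ 0 := by
  unfold Lemma46 lemma46Region
  simp only [Set.mem_setOf_eq, and_imp]

/-- **Proof of Lemma 4.6, the reduction** (`Z22:Lem4.6.pf`): "It suffices to show that the function
`𝒜(1/2+iγ+w,ψ)` has exactly one zero inside the circle `|w| = α(1−c′α𝓛)`, counted with
multiplicity" — typed as: the zero set inside the disc is a singleton `{w₀}` and the zero is simple.
CLAIM (the target of the Rouché step). [Z22 p.22, tex L1210–L1211]
[cite: Zhang2022LandauSiegel, Lemma 4.6 (proof) p.22] -/
def Lem46OneZero : Prop :=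
  ForAllLarge fun D _ χ => ∀ x ∈ PsiOne χ, ∀ ρ ∈ lemma46Region D, calA χ x ρ = 0 →
    ∃ w₀ : ℂ,
      {w : ℂ | ‖w‖ < alpha D * (1 - c' * alpha D * ell D) ∧ calA χ x (1 / 2 + ρ.im * I + w) = 0} = {w₀}
        ∧ deriv (calA χ x) (1 / 2 + ρ.im * I + w₀) ≠ 0

/-- **Implicit in "It suffices" (`Z22:Lem4.6.pf`) and in "Lemma 4.5 and 4.6 together imply (i) and
(ii)" (p.23)**: the zeros of `L(s,ψ)L(s,ψχ)` are symmetric under `s ↦ 1 − s̄` (functional equation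
(4.4) and `\overline{L(s̄,ψ)} = L(s,ψ̄)`), so a zero `β + iγ` with `β ≠ 1/2` comes with the distinct
zero `1 − β + iγ`. The manuscript does not print this step (adjudication item R2-3; the inference
"exactly one zero in a disc centred on the line ⇒ `β = 1/2`" is the tree's
`LFunction_mul_re_eq_half_of_existsUnique_zero`, p404413). CLAIM (standard) — and TRUE
(`llZeroReflect_holds`, from the tree's `LFunction_one_sub_conj_eq_zero` for the primitive
characters `ψ (mod p)` and `ψχ (mod Dp)`, `Skeleton.psiChiPrimitive_holds`); stated for `Re s > 0`
(no trivial zeros). [Z22 p.22, tex L1210; p.20 (4.4)] [cite: Zhang2022LandauSiegel, Lemma 4.6 (proof) p.22] -/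
def LLZeroReflect : Prop :=
  ∀ (D : ℕ) [NeZero D] (χ : DirichletCharacter ℂ D) (x : Chr D), 3 ≤ D → χ.IsQuadratic →
    χ.IsPrimitive → ∀ s : ℂ, 0 < s.re → LL χ x s = 0 → LL χ x (1 - conj s) = 0

/-- **"It suffices to show …"** (`Z22:Lem4.6.pf`): the deduction from "exactly one zero, counted with
multiplicity, of `𝒜(1/2+iγ+·)` in `|w| < α(1−c′α𝓛)`" to Lemma 4.6 — via the reflection symmetry
(`LLZeroReflect`) and "`𝒜` has the same zeros as `L(s,ψ)L(s,ψχ)` in `Ω₁`" (Lemma 4.2, p.21):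
`ρ` and `1 − ρ̄` both lie in the disc (`|β − 1/2| < α² < α(1−c′α𝓛)`), so `β = 1/2`, `w₀ = 0`, the
zero is simple and there is no other zero in the punctured disc. CLAIM (deduction).
[Z22 p.22, tex L1210–L1211] [cite: Zhang2022LandauSiegel, Lemma 4.6 (proof) p.22] -/
def DedLem46 : Prop := Lemma42 → LLZeroReflect → Lem46OneZero c' → Lemma46 c'

/-- **Display `Z22:§4.u048`** (proof of Lemma 4.6): "By the Rouché theorem, this can be reduced to
proving that `|𝒜(1/2+iγ+w,ψ) − (1−P^{−2w})| < |1−P^{−2w}|` for `|w| = α(1−c′α𝓛)`". CLAIM (the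
Rouché hypothesis; it follows from (4.12) and (4.13) once `C·α𝓛 < 6c′α𝓛`, i.e. for `c′ > C/6` —
"`c′` sufficiently large"). [Z22 p.22, tex L1212–L1213]
[cite: Zhang2022LandauSiegel, Lemma 4.6 (proof) p.22] -/
def Step4u048 : Prop :=
  ForAllLarge fun D _ χ => ∀ x ∈ PsiOne χ, ∀ ρ ∈ lemma46Region D, calA χ x ρ = 0 →
    ∀ w : ℂ, ‖w‖ = alpha D * (1 - c' * alpha D * ell D) →
      ‖calA χ x (1 / 2 + ρ.im * I + w) - (1 - Pm2w D w)‖ < ‖1 - Pm2w D w‖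

/-- **"since the function `1 − P^{−2w}` has exactly one zero inside this circle which is at `w = 0`"**
(proof of Lemma 4.6, after `Z22:§4.u048`). CLAIM — and TRUE for `c′ ≥ 0`
(`oneSubPwOneZero_of_nonneg`, from the tree's `Lemma46.zeros_inner_disc`: the zeros of `1 − P^{−2w}`
are `w = ikα`). [Z22 p.22, tex L1213–L1215] [cite: Zhang2022LandauSiegel, Lemma 4.6 (proof) p.22] -/
def OneSubPwOneZero : Prop :=
  ForAllLarge fun D _ _ =>
    {w : ℂ | ‖w‖ < alpha D * (1 - c' * alpha D * ell D) ∧ 1 - Pm2w D w = 0} = {0}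

/-- **(4.12)**: for a zero `ρ = β + iγ` of `𝒜(s,ψ)` as in Lemma 4.6, "`𝒜(1/2+iγ+w,ψ) − (1−P^{−2w}) ≪ α𝓛`
if `|w| < 2α`, the implied constant being independent of `c′`" (no `c′` occurs: the constant `C` is
absolute). CLAIM (assembled structurally in the tree: `Zhang2022.Lemma45.ineq412`).
[Z22 p.22, (4.12), tex L1217–L1219] [cite: Zhang2022LandauSiegel, (4.12) p.22] -/
def Eq412 : Prop :=
  ∃ C : ℝ, ForAllLarge fun D _ χ => ∀ x ∈ PsiOne χ, ∀ ρ ∈ lemma46Region D, calA χ x ρ = 0 →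
    ∀ w : ℂ, ‖w‖ < 2 * alpha D →
      ‖calA χ x (1 / 2 + ρ.im * I + w) - (1 - Pm2w D w)‖ ≤ C * (alpha D * ell D)

/-- **(4.13)**: "`|1 − P^{−2w}| > 6c′α𝓛` if `|w| = α(1−c′α𝓛)`". CLAIM — and TRUE for every `c′ > 0`
(`eq413_of_pos`, the tree's `Lemma46.ineq413` with `δ = c′α𝓛 ≤ 1/200`, i.e. `D` large; the
tree also shows the constant cannot reach `2π`, `Lemma46.lt_two_pi_of_ineq413`).
[Z22 p.22, (4.13), tex L1221–L1223] [cite: Zhang2022LandauSiegel, (4.13) p.22] -/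
def Eq413 : Prop :=
  ForAllLarge fun D _ _ => ∀ w : ℂ, ‖w‖ = alpha D * (1 - c' * alpha D * ell D) →
    6 * c' * alpha D * ell D < ‖1 - Pm2w D w‖

/-- **Display `Z22:§4.u049`** (proof of (4.12)): "Assume `|w| < 2α`. By (4.10) we have
`𝒜(1/2+iγ+w,ψ) − (1−P^{−2w}) = ℬ(1/2+iγ+w,ψ) + P^{−2w} + O(𝓛⁻¹⁰⁰)`" (i.e. (4.10) at the point
`1/2+iγ+w ∈ Ω₃`). CLAIM. [Z22 p.22, tex L1227–L1229] [cite: Zhang2022LandauSiegel, Lemma 4.6 (proof) p.22] -/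
def Step4u049 : Prop :=
  ∃ C : ℝ, ForAllLarge fun D _ χ => ∀ x ∈ PsiOne χ, ∀ ρ ∈ lemma46Region D, calA χ x ρ = 0 →
    ∀ w : ℂ, ‖w‖ < 2 * alpha D →
      ‖(calA χ x (1 / 2 + ρ.im * I + w) - (1 - Pm2w D w))
          - (calB χ x (1 / 2 + ρ.im * I + w) + Pm2w D w)‖ ≤ C * (ell D ^ 100)⁻¹

/-- **"Noting that both `s` and `1 − s` are in `Ω₂` if `s` lies on the segment connecting `ρ` and
`1/2+iγ+w`"** (proof of (4.12), `|w| < 2α`, `ρ` as in Lemma 4.6) — TYPED WITH `1 − s̄` for the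
printed `1 − s`: `Im(1 − s) = −t` lies nowhere near `2πt₀`, and (4.11), which this remark serves, is
stated for `σ′+it` and `1−\overline{(σ′+it)}`; the literal sentence is a print defect (recorded in the
module docstring). CLAIM — and TRUE (`lem46SegmentMemOmega2_holds`, elementary: `2α < 𝓛⁻¹`).
[Z22 p.22, tex L1232] [cite: Zhang2022LandauSiegel, Lemma 4.6 (proof) p.22] -/
def Lem46SegmentMemOmega2 : Prop :=
  ForAllLarge fun D _ _ => ∀ ρ ∈ lemma46Region D, ∀ w : ℂ, ‖w‖ < 2 * alpha D →
    ∀ u : ℝ, 0 ≤ u → u ≤ 1 →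
      (ρ + u * ((1 / 2 : ℂ) + ρ.im * I + w - ρ)) ∈ Omega2 D ∧
        (1 - conj (ρ + u * ((1 / 2 : ℂ) + ρ.im * I + w - ρ))) ∈ Omega2 D

/-- **Display `Z22:§4.u050`, first equality**: "`ℬ(1/2+iγ+w,ψ)/ℬ(ρ,ψ) = exp{∫_ρ^{1/2+iγ+w} ℬ′/ℬ(s,ψ)ds}`"
(segment integral, `|w| < 2α`). CLAIM (structural form kernel-checked for `ℬ` analytic and zero-free
on the segment: tree `Zhang2022.Lemma45.eq_mul_exp_integral_logDeriv_segment`).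
[Z22 p.22, tex L1233–L1235] [cite: Zhang2022LandauSiegel, Lemma 4.6 (proof) p.22] -/
def Step4u050Exp : Prop :=
  ForAllLarge fun D _ χ => ∀ x ∈ PsiOne χ, ∀ ρ ∈ lemma46Region D, calA χ x ρ = 0 →
    ∀ w : ℂ, ‖w‖ < 2 * alpha D →
      calB χ x (1 / 2 + ρ.im * I + w) / calB χ x ρ =
        Complex.exp (((1 / 2 : ℂ) + ρ.im * I + w - ρ) *
          ∫ u in (0 : ℝ)..1,
            deriv (calB χ x) (ρ + u * ((1 / 2 : ℂ) + ρ.im * I + w - ρ)) /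
              calB χ x (ρ + u * ((1 / 2 : ℂ) + ρ.im * I + w - ρ)))

/-- **Display `Z22:§4.u050`, second equality**: "`… = exp{−2w log P + O(α𝓛)}`" (by (4.11) along the
segment). CLAIM (structural form: tree `Zhang2022.Lemma45.exists_eq_mul_exp`).
[Z22 p.22, tex L1233–L1236] [cite: Zhang2022LandauSiegel, Lemma 4.6 (proof) p.22] -/
def Step4u050ExpEst : Prop :=
  ∃ C : ℝ, ForAllLarge fun D _ χ => ∀ x ∈ PsiOne χ, ∀ ρ ∈ lemma46Region D, calA χ x ρ = 0 →
    ∀ w : ℂ, ‖w‖ < 2 * alpha D → ∃ η : ℂ, ‖η‖ ≤ C * (alpha D * ell D) ∧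
      calB χ x (1 / 2 + ρ.im * I + w) / calB χ x ρ =
        Complex.exp (-(2 * w * Real.log (bigP D)) + η)

/-- **Display `Z22:§4.u050`, third equality**: "`… = P^{−2w} + O(α𝓛)`" (`|w| < 2α`, so
`|P^{−2w}| ≤ e^{4π}`). CLAIM (structural form: tree `Zhang2022.Lemma45.norm_sub_mul_exp_le`).
[Z22 p.22, tex L1233–L1237] [cite: Zhang2022LandauSiegel, Lemma 4.6 (proof) p.22] -/
def Step4u050 : Prop :=
  ∃ C : ℝ, ForAllLarge fun D _ χ => ∀ x ∈ PsiOne χ, ∀ ρ ∈ lemma46Region D, calA χ x ρ = 0 →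
    ∀ w : ℂ, ‖w‖ < 2 * alpha D →
      ‖calB χ x (1 / 2 + ρ.im * I + w) / calB χ x ρ - Pm2w D w‖ ≤ C * (alpha D * ell D)

/-- **"Since `ℬ(ρ,ψ) = −1 + O(𝓛⁻¹⁰⁰)` by (4.10)"** (end of the proof of (4.12): `𝒜(ρ) = 0` in
(4.10)). CLAIM (structural form: tree `Zhang2022.Lemma45.norm_calB_add_one_le`).
[Z22 p.23, tex L1239] [cite: Zhang2022LandauSiegel, Lemma 4.6 (proof) p.23] -/
def Lem46CalBAtZero : Prop :=
  ∃ C : ℝ, ForAllLarge fun D _ χ => ∀ x ∈ PsiOne χ, ∀ ρ ∈ lemma46Region D, calA χ x ρ = 0 →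
    ‖calB χ x ρ + 1‖ ≤ C * (ell D ^ 100)⁻¹

/-- **"… the estimate (4.12) follows"** (p.23): the deduction of (4.12) from `Z22:§4.u049`,
`Z22:§4.u050` and `ℬ(ρ) = −1 + O(𝓛⁻¹⁰⁰)` (with `|P^{−2w}| ≤ e^{4π}` for `|w| < 2α` and
`𝓛⁻¹⁰⁰ ≤ α𝓛 = π𝓛⁻⁸`; structural assembly: tree `Zhang2022.Lemma45.ineq412_assembly`). CLAIM
(deduction). [Z22 pp.22–23, tex L1227–L1239] [cite: Zhang2022LandauSiegel, Lemma 4.6 (proof) p.23] -/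
def DedEq412 : Prop := Step4u049 → Step4u050 → Lem46CalBAtZero → Eq412

/-! ### The case analysis on the circle `|w| = α(1−c′α𝓛)` (p.23, displays `Z22:§4.u051`–`u057`) -/

/-- **Display `Z22:§4.u051`**: "Write `w = α(1−c′α𝓛)(cos θ + i sin θ)`" — the polar parametrisation
of the circle `|w| = α(1−c′α𝓛)`. [Z22 p.23, tex L1241]
[cite: Zhang2022LandauSiegel, Lemma 4.6 (proof) p.23] -/
def wPolar (D : ℕ) (θ : ℝ) : ℂ :=
  (alpha D : ℂ) * (((1 - c' * alpha D * ell D : ℝ) : ℂ) * ((Real.cos θ : ℂ) + (Real.sin θ : ℂ) * I))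

/-- **Display `Z22:§4.u052`, first identity, EXACT**: "`|P^{−2w}| = exp{−2π(1−c′α𝓛)cos θ}`" for
`w = α(1−c′α𝓛)(cos θ + i sin θ)` (`D ≥ 2`; the tree's `Lemma46.norm_Pw_polar` at `P = P(D)`).
[Z22 p.23, tex L1242–L1243] [cite: Zhang2022LandauSiegel, Lemma 4.6 (proof) p.23] -/
theorem norm_Pm2w_wPolar {D : ℕ} (hD : 2 ≤ D) (θ : ℝ) :
    ‖Pm2w D (wPolar c' D θ)‖ = Real.exp (-(2 * π * (1 - c' * alpha D * ell D) * Real.cos θ)) := by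
  rw [Pm2w_eq_Pw, wPolar, ← treeAlpha_eq]
  exact Lemma46.norm_Pw_polar (one_lt_bigP hD) _ θ

/-- **Display `Z22:§4.u052`, second identity, EXACT**: "`Im{P^{−2w}} = −|P^{−2w}| sin{2π(1−c′α𝓛) sin θ}`"
for `w = α(1−c′α𝓛)(cos θ + i sin θ)` (`D ≥ 2`; the tree's `Lemma46.im_Pw_polar`).
[Z22 p.23, tex L1242–L1243] [cite: Zhang2022LandauSiegel, Lemma 4.6 (proof) p.23] -/
theorem im_Pm2w_wPolar {D : ℕ} (hD : 2 ≤ D) (θ : ℝ) :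
    (Pm2w D (wPolar c' D θ)).im =
      -(‖Pm2w D (wPolar c' D θ)‖ * Real.sin (2 * π * (1 - c' * alpha D * ell D) * Real.sin θ)) := by
  rw [Pm2w_eq_Pw, wPolar, ← treeAlpha_eq]
  exact Lemma46.im_Pw_polar (one_lt_bigP hD) _ θ

/-- **Display `Z22:§4.u053`**: "if `cos θ > c′α𝓛`, then `|P^{−2w}| < 1 − 6c′α𝓛`" (`w` on the circle
`|w| = α(1−c′α𝓛)`). CLAIM — and TRUE for `c′ > 0`, `D` large (`step4u053_of_pos`, the tree's
`Lemma46.norm_Pw_lt_of_cos_gt`, `δ = c′α𝓛 ≤ 1/200`). [Z22 p.23, tex L1245]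
[cite: Zhang2022LandauSiegel, Lemma 4.6 (proof) p.23] -/
def Step4u053 : Prop :=
  ForAllLarge fun D _ _ => ∀ θ : ℝ, c' * alpha D * ell D < Real.cos θ →
    ‖Pm2w D (wPolar c' D θ)‖ < 1 - 6 * c' * alpha D * ell D

/-- **Display `Z22:§4.u054`**: "if `cos θ < −c′α𝓛`, then `|P^{−2w}| > 1 + 6c′α𝓛`". CLAIM — and TRUE
for `c′ > 0`, `D` large (`step4u054_of_pos`, the tree's `Lemma46.norm_Pw_gt_of_cos_lt`).
[Z22 p.23, tex L1248] [cite: Zhang2022LandauSiegel, Lemma 4.6 (proof) p.23] -/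
def Step4u054 : Prop :=
  ForAllLarge fun D _ _ => ∀ θ : ℝ, Real.cos θ < -(c' * alpha D * ell D) →
    1 + 6 * c' * alpha D * ell D < ‖Pm2w D (wPolar c' D θ)‖

/-- **Display `Z22:§4.u055`**: "if `|cos θ| ≤ c′α𝓛`, then `|Im{P^{−2w}}| > 6c′α𝓛`". CLAIM — and TRUE
for `c′ > 0`, `D` large (`step4u055_of_pos`, the tree's `Lemma46.abs_im_Pw_gt_of_abs_cos_le`).
[Z22 p.23, tex L1251] [cite: Zhang2022LandauSiegel, Lemma 4.6 (proof) p.23] -/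
def Step4u055 : Prop :=
  ForAllLarge fun D _ _ => ∀ θ : ℝ, |Real.cos θ| ≤ c' * alpha D * ell D →
    6 * c' * alpha D * ell D < |(Pm2w D (wPolar c' D θ)).im|

/-- **Display `Z22:§4.u056`**: "since `√(1−(c′α𝓛)²) ≤ |sin θ| ≤ 1`" (when `|cos θ| ≤ c′α𝓛`).
CLAIM — and TRUE outright (`step4u056_holds`, the tree's `Lemma46.abs_sin_le_and_le`).
[Z22 p.23, tex L1255] [cite: Zhang2022LandauSiegel, Lemma 4.6 (proof) p.23] -/
def Step4u056 : Prop :=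
  ∀ (D : ℕ) (θ : ℝ), |Real.cos θ| ≤ c' * alpha D * ell D →
    Real.sqrt (1 - (c' * alpha D * ell D) ^ 2) ≤ |Real.sin θ| ∧ |Real.sin θ| ≤ 1

/-- **Display `Z22:§4.u057`**: "so that `|sin{2π(1−c′α𝓛) sin θ}| = 2πc′α𝓛(1+o(1))`" (uniformly in
`θ` with `|cos θ| ≤ c′α𝓛`), typed as: for every `ε > 0`, eventually
`| |sin{2π(1−c′α𝓛)sin θ}| − 2πc′α𝓛 | ≤ ε·2πc′α𝓛`. CLAIM (an effective lower bound is the tree's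
`Lemma46.abs_sin_inner_gt`). [Z22 p.23, tex L1258]
[cite: Zhang2022LandauSiegel, Lemma 4.6 (proof) p.23] -/
def Step4u057 : Prop :=
  ∀ ε : ℝ, 0 < ε → ForAllLarge fun D _ _ => ∀ θ : ℝ, |Real.cos θ| ≤ c' * alpha D * ell D →
    |(|Real.sin (2 * π * (1 - c' * alpha D * ell D) * Real.sin θ)|) - 2 * π * c' * alpha D * ell D|
      ≤ ε * (2 * π * c' * alpha D * ell D)

/-! ### After Lemma 4.6 (p.23): the gap remark and the two deductions towards Proposition 2.2 -/

/-- **"It is also proved that the gap between any distinct zeros of `𝒜(s,ψ)` in `Ω` is `> α(1−c′α𝓛)`"**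
(p.23, after the proof of Lemma 4.6). Typed over the zeros of `L(s,ψ)L(s,ψχ)` in `Ω`
(`Skeleton.prodZeroSetOmega`, the set Proposition 2.2 is about): in the manuscript `𝒜 = L·L/F` is
the meromorphic quotient, whose zeros in `Ω` are those of `L(s,ψ)L(s,ψχ)` ("`𝒜(s,ψ)` … has the same
zeros as `L(s,ψ)L(s,ψχ)` in `Ω₁`", p.21; `F ≠ 0` near the line by Lemma 4.2) — whereas Lean's
`calA = LL / Fpoly` with `x / 0 = 0` would also vanish at zeros of the Dirichlet polynomial `F` far
from the critical line (`Ω ⊄ Ω₁`), which the sentence does not mean. CLAIM.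
[Z22 p.23, tex L1262–L1263] [cite: Zhang2022LandauSiegel, §4 p.23] -/
def Lem46Gap : Prop :=
  ForAllLarge fun D _ χ => ∀ x ∈ PsiOne χ, ∀ s ∈ prodZeroSetOmega χ x, ∀ s' ∈ prodZeroSetOmega χ x,
    s ≠ s' → alpha D * (1 - c' * alpha D * ell D) < ‖s - s'‖

/-- **"Lemma 4.5 and 4.6 together imply the assertions (i) and (ii) of Proposition 2.2"** (p.23) —
with the implicit inputs made explicit: "`𝒜(s,ψ)` … has the same zeros as `L(s,ψ)L(s,ψχ)` in `Ω₁`"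
and `F ≠ 0` there (Lemma 4.2, p.21), and the reflection of zeros off the line to `σ > 1/2`
(`LLZeroReflect`; Lemma 4.5 covers `1/2 + α² < σ < 1`, Lemma 4.6 covers `1/2 ≤ β < 1/2 + α²`).
CLAIM (deduction; the banked `Skeleton.Ded22 c′` is the coarser "Lemmas 4.2, 4.5–4.7 ⇒ Prop. 2.2").
[Z22 p.23, tex L1262] [cite: Zhang2022LandauSiegel, §4 p.23] -/
def DedProp22i_ii : Prop := Lemma42 → LLZeroReflect → Lemma45 → Lemma46 c' → Prop22i ∧ Prop22ii

/-- **"To complete the proof of the gap assertion (iii), it now suffices to prove Lemma 4.7"** (p.23):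
(iii) (`Skeleton.Prop22iii c′`: consecutive zeros `γ < γ′` of `L(s,ψ)L(s,ψχ)` in `Ω` have
`|γ′ − γ − α| < c′α²𝓛`) from (i), the gap remark `Lem46Gap` and Lemma 4.7's three zeros in
`|w| < α(1+c′α𝓛)` (with Lemma 4.2's "same zeros as `L(s,ψ)L(s,ψχ)`"). CLAIM (deduction).
[Z22 p.23, tex L1263–L1264] [cite: Zhang2022LandauSiegel, §4 p.23] -/
def DedProp22iii : Prop := Lemma42 → Prop22i → Lem46Gap c' → Lemma47 c' → Prop22iii c'

/-! ## Lemma 4.7 (p.23) — banked as `Skeleton.Lemma47 c′`; its proof displays -/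

/-- **Display `Z22:§4.u058`** (proof of Lemma 4.7; `ρ = 1/2 + iγ` a zero of `𝒜`, `|γ − 2πt₀| < 𝓛₁ + 2`):
"In a way similar to the proof of Lemma 4.6, it is direct to verify that
`|𝒜(ρ+w,ψ) − (1−P^{−2w})| < |1−P^{−2w}|` if `|w| = α(1+c′α𝓛)`" (the outer twin of (4.13) is the
tree's `Lemma46.ineq413_outer`). CLAIM. [Z22 p.23, tex L1269–L1272]
[cite: Zhang2022LandauSiegel, Lemma 4.7 (proof) p.23] -/
def Step4u058 : Prop :=
  ForAllLarge fun D _ χ => ∀ x ∈ PsiOne χ, ∀ ρ : ℂ, calA χ x ρ = 0 → ρ.re = 1 / 2 →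
    |ρ.im - 2 * π * t0 D| < ell1 D + 2 →
      ∀ w : ℂ, ‖w‖ = alpha D * (1 + c' * alpha D * ell D) →
        ‖calA χ x (ρ + w) - (1 - Pm2w D w)‖ < ‖1 - Pm2w D w‖

/-- **"… while the later has exactly three zeros inside the same circle which are at `w = 0`, `w = iα`
and `w = −iα`"** (proof of Lemma 4.7). CLAIM — and TRUE for `c′ > 0`, `D` large
(`oneSubPwThreeZeros_of_pos`, the tree's `Lemma46.zeros_outer_disc`; all three zeros are simple,
`Lemma46.deriv_one_sub_Pw_ne_zero`). [Z22 p.23, tex L1272–L1274]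
[cite: Zhang2022LandauSiegel, Lemma 4.7 (proof) p.23] -/
def OneSubPwThreeZeros : Prop :=
  ForAllLarge fun D _ _ =>
    {w : ℂ | ‖w‖ < alpha D * (1 + c' * alpha D * ell D) ∧ 1 - Pm2w D w = 0}
      = {0, I * (alpha D : ℂ), -(I * (alpha D : ℂ))}

/-- **The proof block of Lemma 4.7** (`Z22:Lem4.7.pf`): "Hence [Rouché], the functions `𝒜(ρ+w,ψ)` and
`1−P^{−2w}` have the same number of zeros inside this circle", three — as a deduction to the banked
node `Skeleton.Lemma47 c′`, which types "three zeros counted with multiplicity" as three DISTINCT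
zeros, whence Lemma 4.6 (simplicity, no zero in the punctured inner disc) is an antecedent too.
CLAIM (deduction; Rouché's theorem / the argument principle is the published prerequisite).
[Z22 p.23, tex L1269–L1274] [cite: Zhang2022LandauSiegel, Lemma 4.7 (proof) p.23] -/
def DedLem47 : Prop := Lemma46 c' → Step4u058 c' → OneSubPwThreeZeros c' → Lemma47 c'

/-! ## Lemma 4.8 (p.23) — banked as `Skeleton.Lemma48`; its proof display -/

/-- **Display `Z22:§4.u060`** (proof of Lemma 4.8; `ρ` a zero of `L(s,ψ)L(s,ψχ)` in `Ω`, `ψ ∈ Ψ₁`):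
"It follows from Lemma 4.4 that `F(ρ,ψ) + Z̃(ρ,ψ)F(1−ρ,ψ̄) ≪ 𝓛⁻¹⁷⁹`". CLAIM — and an EDGE
(`step4u060_of_prop22i_of_lemma44`: Lemma 4.4 lives on `Ω₃ = {1/2 − α < σ < 1 + α, …} ⊉ Ω`, so the
step needs `ρ` on the critical line, Prop. 2.2 (i); then `L(ρ,ψ)L(ρ,ψχ) = 0` in Lemma 4.4). The remaining step
"multiplying both sides by `Z̃(ρ,ψ)⁻¹G(ρ,ψ)` and applying Lemma 4.1" is sz-skel's kernel edge
`lemma48_of` (node `Z22:Lem4.8.pf`). [Z22 p.23, tex L1287–L1289]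
[cite: Zhang2022LandauSiegel, Lemma 4.8 (proof) p.23] -/
def Step4u060 : Prop :=
  ∃ C : ℝ, ForAllLarge fun D _ χ => ∀ x ∈ PsiOne χ, ∀ ρ ∈ prodZeroSetOmega χ x,
    ‖Fpoly χ x ρ + tildeZW χ x ρ * FpolyBar χ x (1 - ρ)‖ ≤ C * (ell D ^ 179)⁻¹

/-! ## Kernel-checked items (0 new facts) -/

/-- `2α < 𝓛⁻¹` and `α² < 𝓛⁻¹`, indeed `4α ≤ 𝓛⁻¹`, once `𝓛 ≥ 2` (`α = π𝓛⁻⁹`, `π < 4`).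
[cite: Zhang2022LandauSiegel, §2 (2.10) p.6] -/
private theorem four_alpha_le_inv_ell {D : ℕ} (hD : 2 ≤ D) (hℓ : 2 ≤ ell D) :
    4 * alpha D ≤ (ell D)⁻¹ := by
  have hℓ0 : 0 < ell D := ell_pos hD
  rw [Section2.alpha_eq_pi_div_ell9]
  have h8 : (4 : ℝ) * π ≤ ell D ^ 8 := by
    calc (4 : ℝ) * π ≤ 4 * 4 := by nlinarith [Real.pi_lt_four]
      _ = 2 ^ 4 := by norm_num
      _ ≤ ell D ^ 4 := pow_le_pow_left₀ (by norm_num) hℓ 4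
      _ ≤ ell D ^ 4 * ell D ^ 4 := le_mul_of_one_le_right (by positivity)
          (one_le_pow₀ (by linarith))
      _ = ell D ^ 8 := by ring
  rw [show (4 : ℝ) * (π / ell D ^ 9) = 4 * π / ell D ^ 8 * (ell D)⁻¹ by field_simp]
  calc 4 * π / ell D ^ 8 * (ell D)⁻¹ ≤ 1 * (ell D)⁻¹ := by
        gcongr
        rwa [div_le_one (by positivity)]
    _ = (ell D)⁻¹ := one_mul _

/-- `𝓛 ≥ 2` for `D ≥ 8` (`log 8 > 2`). [cite: Zhang2022LandauSiegel, §2 (2.1) p.3] -/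
private theorem two_le_ell_of_eight_le {D : ℕ} (hD : 8 ≤ D) : 2 ≤ ell D := by
  have hD' : (8 : ℝ) ≤ D := by exact_mod_cast hD
  have h2 : 2 ≤ Real.log 8 := by
    rw [Real.le_log_iff_exp_le (by norm_num)]
    have := Real.exp_one_lt_d9
    have h : Real.exp 2 = Real.exp 1 * Real.exp 1 := by
      rw [show (2 : ℝ) = 1 + 1 by norm_num, Real.exp_add]
    rw [h]; nlinarith [Real.exp_pos 1]
  exact le_trans h2 (Real.log_le_log (by norm_num) hD')

/-- Membership in `Ω₂` spelled out. [cite: Zhang2022LandauSiegel, Lemma 4.3 p.17] -/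
private theorem mem_Omega2_iff' (D : ℕ) (z : ℂ) : z ∈ Omega2 D ↔
    1 / 2 - 1 / ell D < z.re ∧ z.re < 1 + 1 / ell D ∧ |z.im - 2 * π * t0 D| < ell1 D + 4 :=
  Lemma43.mem_Omega2_iff _ _ _ _

/-- Membership of the reflected point `1 − z̄` in `Ω₂` (`Re(1 − z̄) = 1 − Re z`, `Im(1 − z̄) = Im z`).
[cite: Zhang2022LandauSiegel, Lemma 4.5 (proof, Case 2) p.21] -/
private theorem one_sub_conj_mem_Omega2_iff (D : ℕ) (z : ℂ) : (1 - conj z) ∈ Omega2 D ↔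
    1 / 2 - 1 / ell D < 1 - z.re ∧ 1 - z.re < 1 + 1 / ell D ∧
      |z.im - 2 * π * t0 D| < ell1 D + 4 := by
  rw [mem_Omega2_iff']
  simp only [sub_re, one_re, conj_re, sub_im, one_im, conj_im, zero_sub, neg_neg]

/-- **`Lem45Case2MemOmega2` HOLDS**: `1/2 − 𝓛⁻¹ < σ′ ≤ σ < 1/2 + 𝓛⁻¹ < 1 + 𝓛⁻¹` and
`1/2 − 𝓛⁻¹ < 1 − σ′ ≤ 1/2 < 1 + 𝓛⁻¹`; the height is unchanged by `s ↦ 1 − s̄`.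
[cite: Zhang2022LandauSiegel, Lemma 4.5 (proof, Case 2) p.21] -/
theorem lem45Case2MemOmega2_holds : Lem45Case2MemOmega2 := by
  refine ⟨2, fun D _ _ hD _ _ s hs σ' h1 h2 => ?_⟩
  have hℓ : 0 < (ell D)⁻¹ := inv_pos.mpr (ell_pos hD)
  obtain ⟨_, hσ, ht⟩ := hs
  rw [← one_div] at hℓ hσ
  have ht' : |s.im - 2 * π * t0 D| < ell1 D + 4 := by linarith
  have hre : ((σ' : ℂ) + s.im * I).re = σ' := by simp
  have him : ((σ' : ℂ) + s.im * I).im = s.im := by simp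
  rw [mem_Omega2_iff', one_sub_conj_mem_Omega2_iff, hre, him]
  exact ⟨⟨by linarith, by linarith, ht'⟩, by linarith, by linarith, ht'⟩

/-- **`Lem46SegmentMemOmega2` HOLDS** (in the `1 − s̄` reading): on the segment from `ρ = β + iγ`
(`1/2 ≤ β < 1/2 + α²`) to `1/2 + iγ + w` (`|w| < 2α`) one has `|Re s − 1/2| < α² + 2α ≤ 𝓛⁻¹` and
`|Im s − γ| < 2α ≤ 2`. [cite: Zhang2022LandauSiegel, Lemma 4.6 (proof) p.22] -/
theorem lem46SegmentMemOmega2_holds : Lem46SegmentMemOmega2 := by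
  refine ⟨8, fun D _ _ hD _ _ ρ hρ w hw u hu0 hu1 => ?_⟩
  have hD2 : 2 ≤ D := le_trans (by norm_num) hD
  have hℓ2 : 2 ≤ ell D := two_le_ell_of_eight_le hD
  have hα : 0 < alpha D := alpha_pos hD2
  have h4 : 4 * alpha D ≤ (ell D)⁻¹ := four_alpha_le_inv_ell hD2 hℓ2
  rw [← one_div] at h4
  have hinv : 1 / ell D ≤ 1 / 2 := div_le_div_of_nonneg_left (by norm_num) (by norm_num) hℓ2
  have hα2 : alpha D ^ 2 ≤ alpha D := by nlinarith
  obtain ⟨hβ1, hβ2, hγ⟩ := hρ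
  have hwre : |w.re| < 2 * alpha D := lt_of_le_of_lt (abs_re_le_norm w) hw
  have hwim : |w.im| < 2 * alpha D := lt_of_le_of_lt (abs_im_le_norm w) hw
  obtain ⟨hwre1, hwre2⟩ := abs_lt.mp hwre
  obtain ⟨hwim1, hwim2⟩ := abs_lt.mp hwim
  obtain ⟨hγ1, hγ2⟩ := abs_lt.mp hγ
  -- the point `s = ρ + u(1/2 + iγ + w − ρ)`: `Re s = β + u(1/2 + Re w − β)`, `Im s = γ + u·Im w`
  have hre : (ρ + u * ((1 / 2 : ℂ) + ρ.im * I + w - ρ)).re = ρ.re + u * (1 / 2 + w.re - ρ.re) := by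
    simp [mul_re, sub_re, add_re]
  have him : (ρ + u * ((1 / 2 : ℂ) + ρ.im * I + w - ρ)).im = ρ.im + u * w.im := by
    simp [mul_im, sub_im, add_im]
  have key1 : 1 / 2 - 1 / ell D < ρ.re + u * (1 / 2 + w.re - ρ.re) := by nlinarith
  have key2 : ρ.re + u * (1 / 2 + w.re - ρ.re) < 1 / 2 + 1 / ell D := by nlinarith
  have key3 : |ρ.im + u * w.im - 2 * π * t0 D| < ell1 D + 4 := by
    rw [abs_lt]; constructor <;> nlinarith
  rw [mem_Omega2_iff', one_sub_conj_mem_Omega2_iff, hre, him]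
  exact ⟨⟨key1, by linarith, key3⟩, by linarith, by linarith, key3⟩

/-- **`OneSubPwOneZero c′` HOLDS for `c′ ≥ 0`** (the tree's `Lemma46.zeros_inner_disc` with
`δ = c′α𝓛 ∈ [0,1)` for `D` large). [cite: Zhang2022LandauSiegel, Lemma 4.6 (proof) p.22] -/
theorem oneSubPwOneZero_of_nonneg {c' : ℝ} (hc : 0 ≤ c') : OneSubPwOneZero c' := by
  obtain ⟨D₀, hD₀, h⟩ := exists_delta_le c' (1 / 2) (by norm_num)
  refine ⟨D₀, fun D _ _ hD _ _ => ?_⟩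
  have hD2 : 2 ≤ D := le_trans hD₀ hD
  have hδ1 : c' * alpha D * ell D < 1 := lt_of_le_of_lt (h D hD) (by norm_num)
  have hδ0 : 0 ≤ c' * alpha D * ell D := by
    rw [mul_assoc]; exact mul_nonneg hc (alpha_mul_ell_nonneg D)
  have key := Lemma46.zeros_inner_disc (one_lt_bigP hD2) hδ0 hδ1
  rw [treeAlpha_eq] at key
  ext w
  have := Set.ext_iff.mp key w
  simp only [Set.mem_setOf_eq, Set.mem_singleton_iff] at this ⊢
  rw [← this, Pm2w_eq_Pw, sub_eq_zero, eq_comm]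

/-- **`OneSubPwThreeZeros c′` HOLDS for `c′ > 0`** (the tree's `Lemma46.zeros_outer_disc` with
`δ = c′α𝓛 ∈ (0,1]` for `D` large). [cite: Zhang2022LandauSiegel, Lemma 4.7 (proof) p.23] -/
theorem oneSubPwThreeZeros_of_pos {c' : ℝ} (hc : 0 < c') : OneSubPwThreeZeros c' := by
  obtain ⟨D₀, hD₀, h⟩ := exists_delta_le c' 1 one_pos
  refine ⟨D₀, fun D _ _ hD _ _ => ?_⟩
  have hD2 : 2 ≤ D := le_trans hD₀ hD
  have hδ0 : 0 < c' * alpha D * ell D := mul_pos (mul_pos hc (alpha_pos hD2)) (ell_pos hD2)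
  have key := Lemma46.zeros_outer_disc (one_lt_bigP hD2) hδ0 (h D hD)
  rw [treeAlpha_eq] at key
  ext w
  have := Set.ext_iff.mp key w
  simp only [Set.mem_setOf_eq, Set.mem_insert_iff, Set.mem_singleton_iff] at this ⊢
  rw [← this, Pm2w_eq_Pw, sub_eq_zero, eq_comm]

/-- **(4.13) HOLDS for every `c′ > 0`** (`Eq413 c′`; the tree's `Lemma46.ineq413` once
`δ = c′α𝓛 ≤ 1/200`). [cite: Zhang2022LandauSiegel, (4.13) p.22] -/
theorem eq413_of_pos {c' : ℝ} (hc : 0 < c') : Eq413 c' := by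
  obtain ⟨D₀, hD₀, h⟩ := exists_delta_le c' (1 / 200) (by norm_num)
  refine ⟨D₀, fun D _ _ hD _ _ w hw => ?_⟩
  have hD2 : 2 ≤ D := le_trans hD₀ hD
  have hδ0 : 0 < c' * alpha D * ell D := mul_pos (mul_pos hc (alpha_pos hD2)) (ell_pos hD2)
  have hw' : ‖w‖ = Lemma46.alpha (bigP D) * (1 - c' * alpha D * ell D) := by
    rw [treeAlpha_eq]; exact hw
  have key := Lemma46.ineq413 (one_lt_bigP hD2) hδ0 (h D hD) hw'
  rw [Pm2w_eq_Pw]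
  linarith

/-- **`Step4u053 c′` HOLDS for `c′ > 0`**. [cite: Zhang2022LandauSiegel, Lemma 4.6 (proof) p.23] -/
theorem step4u053_of_pos {c' : ℝ} (hc : 0 < c') : Step4u053 c' := by
  obtain ⟨D₀, hD₀, h⟩ := exists_delta_le c' (1 / 200) (by norm_num)
  refine ⟨D₀, fun D _ _ hD _ _ θ hθ => ?_⟩
  have hD2 : 2 ≤ D := le_trans hD₀ hD
  have hδ0 : 0 < c' * alpha D * ell D := mul_pos (mul_pos hc (alpha_pos hD2)) (ell_pos hD2)
  have key := Lemma46.norm_Pw_lt_of_cos_gt (one_lt_bigP hD2) hδ0 (h D hD) hθ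
  rw [treeAlpha_eq] at key
  rw [Pm2w_eq_Pw, wPolar]
  linarith

/-- **`Step4u054 c′` HOLDS for `c′ > 0`**. [cite: Zhang2022LandauSiegel, Lemma 4.6 (proof) p.23] -/
theorem step4u054_of_pos {c' : ℝ} (hc : 0 < c') : Step4u054 c' := by
  obtain ⟨D₀, hD₀, h⟩ := exists_delta_le c' (1 / 200) (by norm_num)
  refine ⟨D₀, fun D _ _ hD _ _ θ hθ => ?_⟩
  have hD2 : 2 ≤ D := le_trans hD₀ hD
  have hδ0 : 0 < c' * alpha D * ell D := mul_pos (mul_pos hc (alpha_pos hD2)) (ell_pos hD2)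
  have key := Lemma46.norm_Pw_gt_of_cos_lt (one_lt_bigP hD2) hδ0 (h D hD) hθ
  rw [treeAlpha_eq] at key
  rw [Pm2w_eq_Pw, wPolar]
  linarith

/-- **`Step4u055 c′` HOLDS for `c′ > 0`**. [cite: Zhang2022LandauSiegel, Lemma 4.6 (proof) p.23] -/
theorem step4u055_of_pos {c' : ℝ} (hc : 0 < c') : Step4u055 c' := by
  obtain ⟨D₀, hD₀, h⟩ := exists_delta_le c' (1 / 200) (by norm_num)
  refine ⟨D₀, fun D _ _ hD _ _ θ hθ => ?_⟩
  have hD2 : 2 ≤ D := le_trans hD₀ hD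
  have hδ0 : 0 < c' * alpha D * ell D := mul_pos (mul_pos hc (alpha_pos hD2)) (ell_pos hD2)
  have key := Lemma46.abs_im_Pw_gt_of_abs_cos_le (one_lt_bigP hD2) hδ0 (h D hD) hθ
  rw [treeAlpha_eq] at key
  rw [Pm2w_eq_Pw, wPolar]
  linarith

/-- **`Step4u056 c′` HOLDS** (any `c′`, `D`, `θ`). [cite: Zhang2022LandauSiegel, Lemma 4.6 (proof) p.23] -/
theorem step4u056_holds (c' : ℝ) : Step4u056 c' :=
  fun _ _ h => Lemma46.abs_sin_le_and_le h

variable (c' : ℝ) in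
/-- `Step4u056` — `_holds` alias of `step4u056_holds` above under the fact's exact name, stated under the
prover's own binders as section variables (appended 2026-08-28, D-0026 bookkeeping: the proof term is the
existing theorem of this file; no statement, definition or attribute is edited; no new named fact; the
ledger's debt table listed the fact unproved). [cite: Zhang2022LandauSiegel, Lemma 4.6 (proof) p.23] -/
theorem _root_.Literature.NumberTheory.LFunctions.Zhang2022.Section4.Step4u056_holds :
    _root_.Literature.NumberTheory.LFunctions.Zhang2022.Section4.Step4u056 c' :=
  _root_.Literature.NumberTheory.LFunctions.Zhang2022.Section4.step4u056_holds (c' := c')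

/-- **`LLZeroReflect` HOLDS** (reflection of the zeros of `L(s,ψ)L(s,ψχ)` with `Re s > 0` under
`s ↦ 1 − s̄`; both characters primitive to moduli `≠ 1`). [cite: Zhang2022LandauSiegel, §4 (4.4) p.20] -/
theorem llZeroReflect_holds : LLZeroReflect := by
  intro D _ χ x hD _ hχ s hs hz
  have hpc : (psiChi χ x).IsPrimitive := psiChiPrimitive_holds D χ x hD hχ
  have hDp : D * x.p ≠ 1 :=
    (lt_of_lt_of_le (by omega : 1 < D) (Nat.le_mul_of_pos_right D x.prime.pos)).ne'
  unfold LL at hz ⊢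
  rcases mul_eq_zero.mp hz with h | h
  · rw [LFunction_one_sub_conj_eq_zero x.prim x.p_ne_one h hs, zero_mul]
  · rw [LFunction_one_sub_conj_eq_zero hpc hDp h hs, mul_zero]

/-- A point of `Ω` ON THE CRITICAL LINE lies in `Ω₃` (`D ≥ 2`): `Ω₃` is `1/2 − α < σ < 1 + α`,
`|t − 2πt₀| < 𝓛₁ + 3`, so `Ω ⊄ Ω₃` (`Ω` reaches `σ ↓ 0`) but `Ω ∩ {σ = 1/2} ⊆ Ω₃`.
[cite: Zhang2022LandauSiegel, §2 (2.7) p.6; Lemma 4.4 p.19] -/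
private theorem mem_Omega3_of_mem_Omega_of_re {D : ℕ} (hD : 2 ≤ D) {s : ℂ} (hs : s ∈ Omega D)
    (hre : s.re = 1 / 2) : s ∈ Omega3 D := by
  have hα := alpha_pos hD
  obtain ⟨_, h2⟩ := hs
  have him : (s - s0 D).im = s.im - 2 * π * t0 D := by
    simp [s0, SmoothWeight.s0, sub_im]
  rw [him] at h2
  refine ⟨by rw [hre]; linarith, by rw [hre]; linarith, by linarith⟩

/-- **`Z22:§4.u060` from Lemma 4.4 and Proposition 2.2 (i)** (EDGE, kernel-checked): Lemma 4.4 is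
stated on `Ω₃ = {1/2 − α < σ < 1 + α, …}`, which does NOT contain `Ω` (`0 < σ < 1`); at a zero
`ρ ∈ Ω` of `L(s,ψ)L(s,ψχ)` ON THE LINE (Prop. 2.2 (i) — "a result which is implied in the proof of
Proposition 2.2") Lemma 4.4 reads `‖0 − F(ρ) − Z̃(ρ)F(1−ρ,ψ̄)‖ ≤ C𝓛⁻¹⁷⁹`.
[cite: Zhang2022LandauSiegel, Lemma 4.8 (proof) p.23] -/
theorem step4u060_of_prop22i_of_lemma44 (hi : Prop22i) (h : Lemma44) : Step4u060 := by
  obtain ⟨C, hC⟩ := h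
  obtain ⟨D₀, hD₀⟩ := hi.and hC
  refine ⟨C, max D₀ 2, fun D _ χ hD hq hp x hx ρ hρ => ?_⟩
  have hD2 : 2 ≤ D := le_trans (le_max_right _ _) hD
  obtain ⟨h1, h2⟩ := hD₀ D χ (le_trans (le_max_left _ _) hD) hq hp
  have hline : ρ.re = 1 / 2 := h1 x hx ρ hρ
  have h44 := h2 x hx ρ (mem_Omega3_of_mem_Omega_of_re hD2 hρ.1 hline)
  have hz : LL χ x ρ = 0 := hρ.2
  rw [hz, zero_sub, ← neg_add', norm_neg] at h44
  exact h44


/-! ## Kernel edges for the deduction nodes of this file (0 new facts) -/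

/-- **Lemma 4.2 ⇒ `F(s,ψ) ≠ 0` on `Ω₁`** for `D` large (`|FG − 1| ≤ C𝓛⁻²²⁷ < 1`).
[cite: Zhang2022LandauSiegel, Lemma 4.2 p.17; §4 p.21] -/
theorem fpoly_ne_zero_of_lemma42 (h42 : Lemma42) :
    ForAllLarge fun D _ χ => ∀ x ∈ PsiOne χ, ∀ s ∈ Omega1 D, Fpoly χ x s ≠ 0 := by
  obtain ⟨C, D₀, hC⟩ := h42
  refine ⟨max D₀ ⌈Real.exp (|C| + 1)⌉₊, fun D _ χ hD hq hp x hx s hs hF => ?_⟩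
  have h := hC D χ (le_trans (le_max_left _ _) hD) hq hp x hx s hs
  rw [hF, zero_mul, zero_sub, norm_neg, norm_one] at h
  have hDexp : Real.exp (|C| + 1) ≤ D :=
    le_trans (Nat.le_ceil _) (by exact_mod_cast le_trans (le_max_right _ _) hD)
  have hDpos : (0 : ℝ) < D := lt_of_lt_of_le (Real.exp_pos _) hDexp
  have hℓ : |C| + 1 ≤ ell D := by
    rw [ell]; exact (Real.le_log_iff_exp_le hDpos).mpr hDexp
  have hℓ1 : 1 ≤ ell D := by linarith [abs_nonneg C]
  have h227 : ell D ≤ ell D ^ 227 := le_self_pow₀ hℓ1 (by norm_num)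
  have hpos : 0 < ell D ^ 227 := by positivity
  have hlt : C * (ell D ^ 227)⁻¹ < 1 := by
    rw [← div_eq_mul_inv, div_lt_one hpos]
    calc C ≤ |C| := le_abs_self C
      _ < ell D := by linarith
      _ ≤ ell D ^ 227 := h227
  linarith

/-- A point with `1/2 ≤ σ < 1/2 + α²`, `|t − 2πt₀| < 𝓛₁ + 2` lies in `Ω₁` once `𝓛 ≥ 2`
(`log 𝓛 > 0`, `α² ≤ 1/64`). [cite: Zhang2022LandauSiegel, Lemma 4.1 p.16; Lemma 4.6 p.22] -/
private theorem mem_Omega1_of_mem_lemma46Region {D : ℕ} (hD : 2 ≤ D) (hℓ : 2 ≤ ell D) {ρ : ℂ}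
    (hρ : ρ ∈ lemma46Region D) : ρ ∈ Omega1 D := by
  obtain ⟨h1, h2, h3⟩ := hρ
  have hℓ0 : 0 < ell D := ell_pos hD
  have hlog : 0 < Real.log (ell D) / (100 * ell D) :=
    div_pos (Real.log_pos (by linarith)) (by positivity)
  have h4 := four_alpha_le_inv_ell hD hℓ
  have hinv : (ell D)⁻¹ ≤ 1 / 2 := by
    rw [inv_eq_one_div]; exact div_le_div_of_nonneg_left (by norm_num) (by norm_num) hℓ
  have hα := alpha_pos hD
  have hα2 : alpha D ^ 2 ≤ 1 / 64 := by nlinarith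
  simp only [Omega1, Lemma43.mem_Omega1_iff]
  exact ⟨by linarith, by linarith, by linarith⟩

/-- **`DedLem46 c′` HOLDS for every `c′`** (kernel EDGE): from Lemma 4.2 (so `F ≠ 0` on `Ω₁` and a
zero of `𝒜 = L·L/F` is a zero of `L(s,ψ)L(s,ψχ)`), the reflection `s ↦ 1 − s̄` of such zeros
(`LLZeroReflect`, discharged above) and "exactly one zero, counted with multiplicity, of
`𝒜(1/2+iγ+·,ψ)` in `|w| < α(1−c′α𝓛)`" (`Lem46OneZero c′`), the three assertions of Lemma 4.6
follow: `ρ − (1/2+iγ) = β − 1/2` and `(1−ρ̄) − (1/2+iγ) = 1/2 − β` both have modulus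
`β − 1/2 < α² < α(1−c′α𝓛)` (for `D` large), so both equal the unique zero `w₀`; hence `β = 1/2`,
`w₀ = 0`, `𝒜′(ρ) ≠ 0`, and `𝒜(ρ+w) ≠ 0` for `0 < |w| < α(1−c′α𝓛)`. This is the step the printed
proof leaves to the reader ("It suffices to show …"). [cite: Zhang2022LandauSiegel, Lemma 4.6 (proof) p.22] -/
theorem dedLem46_holds (c' : ℝ) : DedLem46 c' := by
  intro h42 hrefl hone
  obtain ⟨D₁, hF⟩ := fpoly_ne_zero_of_lemma42 h42
  obtain ⟨D₂, hone'⟩ := hone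
  obtain ⟨D₃, hD₃, hδ⟩ := exists_delta_le c' (1 / 2) (by norm_num)
  refine ⟨max (max D₁ D₂) (max D₃ 8), fun D _ χ hD hq hp x hx ρ hAρ hβ1 hβ2 hγ => ?_⟩
  have hD1 : D₁ ≤ D := le_trans (le_trans (le_max_left _ _) (le_max_left _ _)) hD
  have hD2 : D₂ ≤ D := le_trans (le_trans (le_max_right _ _) (le_max_left _ _)) hD
  have hD3 : D₃ ≤ D := le_trans (le_trans (le_max_left _ _) (le_max_right _ _)) hD
  have hD8 : 8 ≤ D := le_trans (le_trans (le_max_right _ _) (le_max_right _ _)) hD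
  have hDtwo : 2 ≤ D := le_trans (by norm_num) hD8
  have hDthree : 3 ≤ D := le_trans (by norm_num) hD8
  have hℓ2 : 2 ≤ ell D := two_le_ell_of_eight_le hD8
  have hα : 0 < alpha D := alpha_pos hDtwo
  have h4 := four_alpha_le_inv_ell hDtwo hℓ2
  have hinv : (ell D)⁻¹ ≤ 1 / 2 := by
    rw [inv_eq_one_div]; exact div_le_div_of_nonneg_left (by norm_num) (by norm_num) hℓ2
  have hδ' : c' * alpha D * ell D ≤ 1 / 2 := hδ D hD3
  -- the radius `r = α(1 − c′α𝓛)` exceeds `α²`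
  set r : ℝ := alpha D * (1 - c' * alpha D * ell D) with hr
  have hr2 : alpha D ^ 2 < r := by rw [hr]; nlinarith
  have hρreg : ρ ∈ lemma46Region D := ⟨hβ1, hβ2, hγ⟩
  -- the unique zero `w₀`
  obtain ⟨w₀, hset, hderiv⟩ := hone' D χ hD2 hq hp x hx ρ hρreg hAρ
  set z : ℂ := 1 / 2 + ρ.im * I with hz
  -- `ρ` itself: `w₁ = β − 1/2`
  set w₁ : ℂ := ((ρ.re - 1 / 2 : ℝ) : ℂ) with hw₁
  have hzw₁ : z + w₁ = ρ := by
    apply Complex.ext <;> simp [hz, hw₁]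
  have hnw₁ : ‖w₁‖ = ρ.re - 1 / 2 := by
    rw [hw₁, Complex.norm_real, Real.norm_eq_abs, abs_of_nonneg (by linarith)]
  have hw₁S : w₁ ∈ {w : ℂ | ‖w‖ < alpha D * (1 - c' * alpha D * ell D) ∧
      calA χ x (1 / 2 + ρ.im * I + w) = 0} := by
    refine ⟨by rw [hnw₁, ← hr]; linarith, ?_⟩
    rw [← hz, hzw₁]; exact hAρ
  rw [hset, Set.mem_singleton_iff] at hw₁S
  -- the reflected zero `1 − ρ̄`: `w₂ = 1/2 − β`
  have hΩ1 : ρ ∈ Omega1 D := mem_Omega1_of_mem_lemma46Region hDtwo hℓ2 hρreg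
  have hFρ : Fpoly χ x ρ ≠ 0 := hF D χ hD1 hq hp x hx ρ hΩ1
  have hLLρ : LL χ x ρ = 0 := by
    have h := hAρ
    rw [calA, div_eq_zero_iff] at h
    exact h.resolve_right hFρ
  have hLLρ' : LL χ x (1 - conj ρ) = 0 := hrefl D χ x hDthree hq hp ρ (by linarith) hLLρ
  have hAρ' : calA χ x (1 - conj ρ) = 0 := by rw [calA, hLLρ', zero_div]
  set w₂ : ℂ := ((1 / 2 - ρ.re : ℝ) : ℂ) with hw₂
  have hzw₂ : z + w₂ = 1 - conj ρ := by
    apply Complex.ext <;> simp [hz, hw₂]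
    ring
  have hnw₂ : ‖w₂‖ = ρ.re - 1 / 2 := by
    rw [hw₂, Complex.norm_real, Real.norm_eq_abs, abs_of_nonpos (by linarith)]
    ring
  have hw₂S : w₂ ∈ {w : ℂ | ‖w‖ < alpha D * (1 - c' * alpha D * ell D) ∧
      calA χ x (1 / 2 + ρ.im * I + w) = 0} := by
    refine ⟨by rw [hnw₂, ← hr]; linarith, ?_⟩
    rw [← hz, hzw₂]; exact hAρ'
  rw [hset, Set.mem_singleton_iff] at hw₂S
  -- hence `w₁ = w₂`, i.e. `β − 1/2 = 1/2 − β`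
  have hβ : ρ.re = 1 / 2 := by
    have h : w₁ = w₂ := hw₁S.trans hw₂S.symm
    rw [hw₁, hw₂, Complex.ofReal_inj] at h
    linarith
  have hw₁0 : w₁ = 0 := by rw [hw₁, hβ]; simp
  have hw₀ : w₀ = 0 := hw₁S.symm.trans hw₁0
  have hzρ : z = ρ := by rw [← hzw₁, hw₁0, add_zero]
  refine ⟨hβ, ?_, fun w hw0 hwr hAw => ?_⟩
  · have h := hderiv
    rwa [hw₀, add_zero, hzρ] at h
  · have hwS : w ∈ {w : ℂ | ‖w‖ < alpha D * (1 - c' * alpha D * ell D) ∧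
        calA χ x (1 / 2 + ρ.im * I + w) = 0} := by
      refine ⟨hwr, ?_⟩
      show calA χ x (z + w) = 0
      rw [hzρ]; exact hAw
    rw [hset, Set.mem_singleton_iff, hw₀] at hwS
    rw [hwS, norm_zero] at hw0
    exact lt_irrefl 0 hw0

variable (c' : ℝ) in
/-- `DedLem46` — `_holds` alias of `dedLem46_holds` above under the fact's exact name, stated under the
prover's own binders as section variables (appended 2026-08-28, D-0026 bookkeeping: the proof term is the
existing theorem of this file; no statement, definition or attribute is edited; no new named fact; the
ledger's debt table listed the fact unproved). [cite: Zhang2022LandauSiegel, Lemma 4.6 (proof) p.22] -/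
theorem _root_.Literature.NumberTheory.LFunctions.Zhang2022.Section4.DedLem46_holds :
    _root_.Literature.NumberTheory.LFunctions.Zhang2022.Section4.DedLem46 c' :=
  _root_.Literature.NumberTheory.LFunctions.Zhang2022.Section4.dedLem46_holds (c' := c')


/-- `exp(−𝓛) ≤ 𝓛⁻¹` and `P^{−1/𝓛} = exp(−𝓛⁸) ≤ 𝓛⁻¹` bookkeeping: for `D ≥ 2` and `1 ≤ 𝓛`,
`P^{1/2 − σ} ≤ 𝓛⁻¹` whenever `σ ≥ 1/2 + 𝓛⁻¹`. [cite: Zhang2022LandauSiegel, Lemma 4.5 (proof, Case 1) p.21] -/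
private theorem bigP_rpow_le_inv_ell {D : ℕ} (hD : 2 ≤ D) (hℓ1 : 1 ≤ ell D) {σ : ℝ}
    (hσ : 1 / 2 + (ell D)⁻¹ ≤ σ) : bigP D ^ (1 / 2 - σ) ≤ (ell D)⁻¹ := by
  have hℓ0 := ell_pos hD
  rw [bigP, ← Real.exp_mul]
  have h8 : ell D ≤ ell D ^ 8 := le_self_pow₀ hℓ1 (by norm_num)
  have h1 : ell D ^ 9 * (1 / 2 - σ) ≤ -ell D := by
    have : ell D ^ 9 * (1 / 2 - σ) ≤ ell D ^ 9 * (-(ell D)⁻¹) :=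
      mul_le_mul_of_nonneg_left (by linarith) (by positivity)
    have h9 : ell D ^ 9 * (-(ell D)⁻¹) = -ell D ^ 8 := by field_simp
    linarith
  have h2 : ell D ≤ Real.exp (ell D) := by linarith [Real.add_one_le_exp (ell D)]
  calc Real.exp (ell D ^ 9 * (1 / 2 - σ)) ≤ Real.exp (-ell D) := Real.exp_le_exp.mpr h1
    _ = (Real.exp (ell D))⁻¹ := Real.exp_neg _
    _ ≤ (ell D)⁻¹ := inv_anti₀ hℓ0 h2

/-- **`DedLem45` HOLDS** (kernel EDGE): Lemma 4.5 from (4.10), Case 1's "`ℬ(s,ψ) ≪ P^{1/2−σ}`"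
(`Step4u044`) and Case 2's "`|𝒜(s,ψ)| ≫ α`" (`Step4u046Alpha`). Case 1 (`σ ≥ 1/2 + 𝓛⁻¹`): if
`𝒜(s) = 0` then (4.10) gives `1 ≤ |ℬ(s)| + C₀𝓛⁻¹⁰⁰ ≤ (|C₁| + |C₀|)𝓛⁻¹ < 1` once `𝓛 > |C₀| + |C₁|`
(`P^{1/2−σ} ≤ P^{−1/𝓛} = e^{−𝓛⁸} ≤ 𝓛⁻¹`); Case 2: `|𝒜(s)| ≥ cα > 0`.
[cite: Zhang2022LandauSiegel, Lemma 4.5 (proof) pp.21–22] -/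
theorem dedLem45_holds : DedLem45 := by
  intro h410 h44 h46
  obtain ⟨C₀, hA⟩ := h410
  obtain ⟨C₁, hB⟩ := h44
  obtain ⟨c, hc, hC⟩ := h46
  obtain ⟨D₀, hall⟩ := (hA.and hB).and hC
  refine ⟨max D₀ (max 2 ⌈Real.exp (|C₀| + |C₁| + 1)⌉₊),
    fun D _ χ hD hq hp x hx s h1 h2 h3 hA0 => ?_⟩
  have hD₀ : D₀ ≤ D := le_trans (le_max_left _ _) hD
  have hD2 : 2 ≤ D := le_trans (le_trans (le_max_left _ _) (le_max_right _ _)) hD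
  have hDexp : Real.exp (|C₀| + |C₁| + 1) ≤ D := le_trans (Nat.le_ceil _)
    (by exact_mod_cast le_trans (le_trans (le_max_right _ _) (le_max_right _ _)) hD)
  have hDpos : (0 : ℝ) < D := lt_of_lt_of_le (Real.exp_pos _) hDexp
  have hℓ : |C₀| + |C₁| + 1 ≤ ell D := by
    rw [ell]; exact (Real.le_log_iff_exp_le hDpos).mpr hDexp
  have hℓ1 : 1 ≤ ell D := by linarith [abs_nonneg C₀, abs_nonneg C₁]
  have hℓ0 : 0 < ell D := ell_pos hD2
  obtain ⟨⟨hA', hB'⟩, hC'⟩ := hall D χ hD₀ hq hp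
  have hα := alpha_pos hD2
  rcases lt_or_ge s.re (1 / 2 + (ell D)⁻¹) with hcase | hcase
  · -- Case 2: `|𝒜(s)| ≥ cα > 0`
    have h := hC' x hx s ⟨h1.le, hcase, h3⟩
    rw [hA0, norm_zero] at h
    nlinarith
  · -- Case 1: `ℬ ≪ P^{1/2−σ}` and (4.10)
    have hΩ3 : s ∈ Omega3 D :=
      ⟨by linarith [sq_nonneg (alpha D)], by linarith, by linarith⟩
    have e410 := hA' x hx s hΩ3
    have eB := hB' x hx s ⟨hcase, h2, h3⟩
    rw [hA0, zero_sub] at e410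
    have hlow : 1 - ‖calB χ x s‖ ≤ C₀ * (ell D ^ 100)⁻¹ := by
      have h := norm_sub_norm_le (-1 : ℂ) (calB χ x s)
      rw [norm_neg, norm_one] at h
      linarith
    have hinv100 : (ell D ^ 100)⁻¹ ≤ (ell D)⁻¹ :=
      inv_anti₀ hℓ0 (le_self_pow₀ hℓ1 (by norm_num))
    have hP : bigP D ^ (1 / 2 - s.re) ≤ (ell D)⁻¹ := bigP_rpow_le_inv_ell hD2 hℓ1 hcase
    have hi0 : 0 ≤ (ell D ^ 100)⁻¹ := by positivity
    have hP0 : 0 ≤ bigP D ^ (1 / 2 - s.re) := Real.rpow_nonneg (bigP_pos D).le _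
    have t1 : C₀ * (ell D ^ 100)⁻¹ ≤ |C₀| * (ell D)⁻¹ :=
      le_trans (mul_le_mul_of_nonneg_right (le_abs_self C₀) hi0)
        (mul_le_mul_of_nonneg_left hinv100 (abs_nonneg C₀))
    have t2 : C₁ * bigP D ^ (1 / 2 - s.re) ≤ |C₁| * (ell D)⁻¹ :=
      le_trans (mul_le_mul_of_nonneg_right (le_abs_self C₁) hP0)
        (mul_le_mul_of_nonneg_left hP (abs_nonneg C₁))
    have hsum : 1 ≤ (|C₀| + |C₁|) * (ell D)⁻¹ := by linarith
    have hlt : (|C₀| + |C₁|) * (ell D)⁻¹ < 1 := by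
      rw [← div_eq_mul_inv, div_lt_one hℓ0]; linarith
    linarith


/-- A zero `ρ` as in Lemma 4.6 (`1/2 ≤ β < 1/2 + α²`, `|γ − 2πt₀| < 𝓛₁ + 2`) lies in `Ω₃` (`D ≥ 8`).
[cite: Zhang2022LandauSiegel, Lemma 4.4 p.19; Lemma 4.6 p.22] -/
private theorem mem_Omega3_of_mem_lemma46Region {D : ℕ} (hD : 8 ≤ D) {ρ : ℂ}
    (hρ : ρ ∈ lemma46Region D) : ρ ∈ Omega3 D := by
  have hD2 : 2 ≤ D := le_trans (by norm_num) hD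
  have hℓ2 := two_le_ell_of_eight_le hD
  obtain ⟨h1, h2, h3⟩ := hρ
  have hα := alpha_pos hD2
  have h4 := four_alpha_le_inv_ell hD2 hℓ2
  have hinv : (ell D)⁻¹ ≤ 1 / 2 := by
    rw [inv_eq_one_div]; exact div_le_div_of_nonneg_left (by norm_num) (by norm_num) hℓ2
  have hα2 : alpha D ^ 2 ≤ 1 / 64 := by nlinarith
  exact ⟨by linarith, by linarith, by linarith⟩

/-- **"Since `ℬ(ρ,ψ) = −1 + O(𝓛⁻¹⁰⁰)` by (4.10)" from (4.10)** (kernel EDGE `Eq410 → Lem46CalBAtZero`):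
`ρ ∈ Ω₃` and `𝒜(ρ) = 0` in (4.10). [cite: Zhang2022LandauSiegel, Lemma 4.6 (proof) p.23] -/
theorem lem46CalBAtZero_of_eq410 (h : Eq410) : Lem46CalBAtZero := by
  obtain ⟨C, D₀, hC⟩ := h
  refine ⟨C, max D₀ 8, fun D _ χ hD hq hp x hx ρ hρ hA => ?_⟩
  have hD8 : 8 ≤ D := le_trans (le_max_right _ _) hD
  have h410 := hC D χ (le_trans (le_max_left _ _) hD) hq hp x hx ρ
    (mem_Omega3_of_mem_lemma46Region hD8 hρ)
  exact Lemma45.norm_calB_add_one_le hA h410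

/-- **Display `Z22:§4.u049` from (4.10), ON THE PART OF THE DISC `|w| < 2α` THAT (4.10) COVERS**
(kernel EDGE): (4.10) is stated on `Ω₃ = {1/2 − α < σ < 1 + α, |t − 2πt₀| < 𝓛₁ + 3}`, while
`s = 1/2 + iγ + w`, `|w| < 2α` has `σ ∈ (1/2 − 2α, 1/2 + 2α)`; so the printed "By (4.10)" reaches
exactly the `w` with `Re w > −α` (which contains Lemma 4.6's circle `|w| = α(1−c′α𝓛)`, but NOT the
leftmost points of Lemma 4.7's circle `|w| = α(1+c′α𝓛)`). The node `Step4u049` itself (all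
`|w| < 2α`) is the manuscript's claim; this theorem is the derivable part — range remark recorded on
STATUS for the dag (repair class: widen `Ω₃` in Lemma 4.4).
[cite: Zhang2022LandauSiegel, Lemma 4.6 (proof) p.22] -/
theorem step4u049_inner_of_eq410 (h : Eq410) :
    ∃ C : ℝ, ForAllLarge fun D _ χ => ∀ x ∈ PsiOne χ, ∀ ρ ∈ lemma46Region D, calA χ x ρ = 0 →
      ∀ w : ℂ, ‖w‖ < 2 * alpha D → -alpha D < w.re →
        ‖(calA χ x (1 / 2 + ρ.im * I + w) - (1 - Pm2w D w))
            - (calB χ x (1 / 2 + ρ.im * I + w) + Pm2w D w)‖ ≤ C * (ell D ^ 100)⁻¹ := by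
  obtain ⟨C, D₀, hC⟩ := h
  refine ⟨C, max D₀ 8, fun D _ χ hD hq hp x hx ρ hρ _ w hw hwre => ?_⟩
  have hD8 : 8 ≤ D := le_trans (le_max_right _ _) hD
  have hD2 : 2 ≤ D := le_trans (by norm_num) hD8
  have hℓ2 := two_le_ell_of_eight_le hD8
  have hα := alpha_pos hD2
  have h4 := four_alpha_le_inv_ell hD2 hℓ2
  have hinv : (ell D)⁻¹ ≤ 1 / 2 := by
    rw [inv_eq_one_div]; exact div_le_div_of_nonneg_left (by norm_num) (by norm_num) hℓ2
  obtain ⟨_, _, hγ⟩ := hρ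
  have hwre2 : |w.re| < 2 * alpha D := lt_of_le_of_lt (abs_re_le_norm w) hw
  have hwim2 : |w.im| < 2 * alpha D := lt_of_le_of_lt (abs_im_le_norm w) hw
  obtain ⟨_, hwre'⟩ := abs_lt.mp hwre2
  obtain ⟨hwim1, hwim2'⟩ := abs_lt.mp hwim2
  obtain ⟨hγ1, hγ2⟩ := abs_lt.mp hγ
  have hre : ((1 / 2 : ℂ) + ρ.im * I + w).re = 1 / 2 + w.re := by simp
  have him : ((1 / 2 : ℂ) + ρ.im * I + w).im = ρ.im + w.im := by simp
  have hΩ3 : ((1 / 2 : ℂ) + ρ.im * I + w) ∈ Omega3 D := by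
    refine ⟨?_, ?_, ?_⟩
    · rw [hre]; linarith
    · rw [hre]; linarith
    · rw [him, abs_lt]; constructor <;> linarith
  have h410 := hC D χ (le_trans (le_max_left _ _) hD) hq hp x hx _ hΩ3
  have heq : (calA χ x (1 / 2 + ρ.im * I + w) - (1 - Pm2w D w))
      - (calB χ x (1 / 2 + ρ.im * I + w) + Pm2w D w)
      = calA χ x (1 / 2 + ρ.im * I + w) - 1 - calB χ x (1 / 2 + ρ.im * I + w) := by ring
  rw [heq]
  exact h410

/-- `|P^{−2w}| ≤ e^{4π}` for `|w| < 2α` (the tree's `Lemma45.norm_Pw_le_of_norm_lt`).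
[cite: Zhang2022LandauSiegel, Lemma 4.6 (proof) p.22] -/
theorem norm_Pm2w_le {D : ℕ} (hD : 2 ≤ D) {w : ℂ} (hw : ‖w‖ < 2 * alpha D) :
    ‖Pm2w D w‖ ≤ Real.exp (4 * π) := by
  rw [Pm2w_eq_Pw, Lemma46.Pw_def]
  have h : -(2 * w * (Real.log (bigP D) : ℂ)) = -(2 * (Real.log (bigP D) : ℂ)) * w := by ring
  rw [h]
  exact Lemma45.norm_Pw_le_of_norm_lt (one_lt_bigP hD) hw

/-- `𝓛⁻¹⁰⁰ ≤ α𝓛 = π𝓛⁻⁸` and `𝓛⁻¹⁰⁰ ≤ 1` for `𝓛 ≥ 1`. [cite: Zhang2022LandauSiegel, Lemma 4.6 (proof) p.22] -/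
private theorem inv_ell100_le_alpha_mul_ell {D : ℕ} (hD : 2 ≤ D) (hℓ1 : 1 ≤ ell D) :
    (ell D ^ 100)⁻¹ ≤ alpha D * ell D ∧ (ell D ^ 100)⁻¹ ≤ 1 := by
  have hℓ0 := ell_pos hD
  rw [alpha_mul_ell hD]
  constructor
  · rw [inv_eq_one_div, div_le_div_iff₀ (by positivity) (by positivity), one_mul]
    have h1 : ell D ^ 8 ≤ ell D ^ 100 := pow_le_pow_right₀ hℓ1 (by norm_num)
    have h2 : ell D ^ 100 ≤ π * ell D ^ 100 :=
      le_mul_of_one_le_left (by positivity) (by linarith [Real.pi_gt_three])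
    exact h1.trans h2
  · exact inv_le_one_of_one_le₀ (one_le_pow₀ hℓ1)

/-- **`DedEq412` HOLDS** (kernel EDGE): (4.12) from `Z22:§4.u049` (`𝒜 − (1−p) = ℬ + p + O(𝓛⁻¹⁰⁰)`,
`p = P^{−2w}`), `Z22:§4.u050` (`ℬ(1/2+iγ+w)/ℬ(ρ) = p + O(α𝓛)`) and `ℬ(ρ) = −1 + O(𝓛⁻¹⁰⁰)`:
`𝒜 − (1−p) = (ℬ − ℬ(ρ)p) + (ℬ(ρ)+1)p + O(𝓛⁻¹⁰⁰)` with `|ℬ − ℬ(ρ)p| ≤ |ℬ(ρ)|·Cα𝓛`,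
`|ℬ(ρ)| ≤ 1 + O(𝓛⁻¹⁰⁰)`, `|p| ≤ e^{4π}`, `𝓛⁻¹⁰⁰ ≤ α𝓛` (the tree's `Lemma45.ineq412_assembly`).
The constant obtained involves only the three input constants and `e^{4π}` — no `c′`.
[cite: Zhang2022LandauSiegel, (4.12) p.22] -/
theorem dedEq412_holds : DedEq412 := by
  intro h49 h50 hb
  obtain ⟨C₉, hA⟩ := h49
  obtain ⟨C₅, hB⟩ := h50
  obtain ⟨C₁, hZ⟩ := hb
  obtain ⟨D₀, hall⟩ := (hA.and hB).and hZ
  refine ⟨(|C₁| + |C₉|) * (1 + Real.exp (4 * π)) + (1 + |C₁|) * |C₅|,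
    max D₀ (max 2 ⌈Real.exp (|C₁| + 1)⌉₊), fun D _ χ hD hq hp x hx ρ hρ hAρ w hw => ?_⟩
  have hD₀ : D₀ ≤ D := le_trans (le_max_left _ _) hD
  have hD2 : 2 ≤ D := le_trans (le_trans (le_max_left _ _) (le_max_right _ _)) hD
  have hDexp : Real.exp (|C₁| + 1) ≤ D := le_trans (Nat.le_ceil _)
    (by exact_mod_cast le_trans (le_trans (le_max_right _ _) (le_max_right _ _)) hD)
  have hDpos : (0 : ℝ) < D := lt_of_lt_of_le (Real.exp_pos _) hDexp
  have hℓ : |C₁| + 1 ≤ ell D := by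
    rw [ell]; exact (Real.le_log_iff_exp_le hDpos).mpr hDexp
  have hℓ1 : 1 ≤ ell D := by linarith [abs_nonneg C₁]
  have hℓ0 : 0 < ell D := ell_pos hD2
  obtain ⟨⟨hA', hB'⟩, hZ'⟩ := hall D χ hD₀ hq hp
  have e49 := hA' x hx ρ hρ hAρ w hw
  have e50 := hB' x hx ρ hρ hAρ w hw
  have eZ := hZ' x hx ρ hρ hAρ
  set Aw := calA χ x (1 / 2 + ρ.im * I + w) with hAw
  set Bw := calB χ x (1 / 2 + ρ.im * I + w) with hBw
  set Bρ := calB χ x ρ with hBρ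
  set p := Pm2w D w with hpdef
  obtain ⟨hEη, hE1⟩ := inv_ell100_le_alpha_mul_ell hD2 hℓ1
  have hE0 : 0 ≤ (ell D ^ 100)⁻¹ := by positivity
  have hη0 : 0 ≤ alpha D * ell D := alpha_mul_ell_nonneg D
  have hp : ‖p‖ ≤ Real.exp (4 * π) := norm_Pm2w_le hD2 hw
  -- `ℬ(ρ) ≠ 0` (else `1 ≤ C₁𝓛⁻¹⁰⁰ ≤ |C₁|/𝓛 < 1`)
  have hBρ0 : Bρ ≠ 0 := by
    intro h0
    rw [h0, zero_add, norm_one] at eZ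
    have h100 : (ell D ^ 100)⁻¹ ≤ (ell D)⁻¹ := inv_anti₀ hℓ0 (le_self_pow₀ hℓ1 (by norm_num))
    have h1 : C₁ * (ell D ^ 100)⁻¹ ≤ |C₁| * (ell D)⁻¹ :=
      le_trans (mul_le_mul_of_nonneg_right (le_abs_self C₁) hE0)
        (mul_le_mul_of_nonneg_left h100 (abs_nonneg C₁))
    have hlt : |C₁| * (ell D)⁻¹ < 1 := by
      rw [← div_eq_mul_inv, div_lt_one hℓ0]; linarith
    linarith
  have hBρn : ‖Bρ‖ ≤ 1 + |C₁| * (ell D ^ 100)⁻¹ := by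
    have h := norm_add_le (Bρ + 1) (-1 : ℂ)
    rw [add_neg_cancel_right, norm_neg, norm_one] at h
    have : C₁ * (ell D ^ 100)⁻¹ ≤ |C₁| * (ell D ^ 100)⁻¹ :=
      mul_le_mul_of_nonneg_right (le_abs_self C₁) hE0
    linarith
  -- the ratio estimate in the form `|ℬ(ρ+w) − ℬ(ρ)p| ≤ |ℬ(ρ)|·|C₅|α𝓛`
  have hratio : ‖Bw - Bρ * p‖ ≤ (1 + |C₁| * (ell D ^ 100)⁻¹) * (|C₅| * (alpha D * ell D)) := by
    have hfac : Bw - Bρ * p = Bρ * (Bw / Bρ - p) := by field_simp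
    rw [hfac, norm_mul]
    have h1 : ‖Bw / Bρ - p‖ ≤ |C₅| * (alpha D * ell D) :=
      le_trans e50 (mul_le_mul_of_nonneg_right (le_abs_self C₅) hη0)
    exact mul_le_mul hBρn h1 (norm_nonneg _) (by positivity)
  -- (4.10) at `ρ` and at `ρ + w` in the shape of the tree's `ineq412_assembly`
  have h410ρ : ‖calA χ x ρ - 1 - Bρ‖ ≤ |C₁| * (ell D ^ 100)⁻¹ := by
    rw [hAρ, zero_sub, ← neg_add', norm_neg, add_comm]
    exact le_trans eZ (mul_le_mul_of_nonneg_right (le_abs_self C₁) hE0)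
  have h410w : ‖Aw - 1 - Bw‖ ≤ |C₉| * (ell D ^ 100)⁻¹ := by
    have heq : Aw - 1 - Bw = (Aw - (1 - p)) - (Bw + p) := by ring
    rw [heq]
    exact le_trans e49 (mul_le_mul_of_nonneg_right (le_abs_self C₉) hE0)
  have hE' : |C₁| * (ell D ^ 100)⁻¹ ≤ (|C₁| + |C₉|) * (ell D ^ 100)⁻¹ := by
    nlinarith [abs_nonneg C₉]
  have hE'' : |C₉| * (ell D ^ 100)⁻¹ ≤ (|C₁| + |C₉|) * (ell D ^ 100)⁻¹ := by
    nlinarith [abs_nonneg C₁]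
  have hmain := Lemma45.ineq412_assembly (E := (|C₁| + |C₉|) * (ell D ^ 100)⁻¹) hAρ
    (h410ρ.trans hE') (h410w.trans hE'') hratio
  -- bookkeeping: everything is `≤ (…)·α𝓛`
  have hab : 0 ≤ |C₁| + |C₉| := by positivity
  have t1 : (|C₁| + |C₉|) * (ell D ^ 100)⁻¹ ≤ (|C₁| + |C₉|) * (alpha D * ell D) :=
    mul_le_mul_of_nonneg_left hEη hab
  have t2 : (1 + |C₁| * (ell D ^ 100)⁻¹) * (|C₅| * (alpha D * ell D))
      ≤ (1 + |C₁|) * (|C₅| * (alpha D * ell D)) := by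
    apply mul_le_mul_of_nonneg_right _ (mul_nonneg (abs_nonneg _) hη0)
    nlinarith [abs_nonneg C₁]
  have t3 : (|C₁| + |C₉|) * (ell D ^ 100)⁻¹ * ‖p‖
      ≤ (|C₁| + |C₉|) * (alpha D * ell D) * Real.exp (4 * π) :=
    mul_le_mul t1 hp (norm_nonneg _) (mul_nonneg hab hη0)
  calc ‖Aw - (1 - p)‖
      ≤ (|C₁| + |C₉|) * (ell D ^ 100)⁻¹
          + (1 + |C₁| * (ell D ^ 100)⁻¹) * (|C₅| * (alpha D * ell D))
          + (|C₁| + |C₉|) * (ell D ^ 100)⁻¹ * ‖p‖ := hmain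
    _ ≤ (|C₁| + |C₉|) * (alpha D * ell D) + (1 + |C₁|) * (|C₅| * (alpha D * ell D))
          + (|C₁| + |C₉|) * (alpha D * ell D) * Real.exp (4 * π) := by linarith
    _ = ((|C₁| + |C₉|) * (1 + Real.exp (4 * π)) + (1 + |C₁|) * |C₅|) * (alpha D * ell D) := by
        ring

/-- **The Rouché hypothesis `Z22:§4.u048` from (4.12) and (4.13), for `c′` sufficiently large**
(kernel EDGE; "`c′` is a sufficiently [large] constant" made explicit): if (4.12) holds with
constant `C`, then for every `c′ > max(C/6, 0)` and `D` large, on `|w| = α(1−c′α𝓛)` (`< 2α`)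
`|𝒜(1/2+iγ+w) − (1−P^{−2w})| ≤ Cα𝓛 ≤ 6c′α𝓛 < |1 − P^{−2w}|` by (4.13) (`eq413_of_pos`).
[cite: Zhang2022LandauSiegel, Lemma 4.6 (proof) p.22] -/
theorem step4u048_of_eq412 (h : Eq412) : ∃ c₀ : ℝ, ∀ c' : ℝ, c₀ < c' → Step4u048 c' := by
  obtain ⟨C, hC⟩ := h
  refine ⟨max (C / 6) 0, fun c' hc' => ?_⟩
  have hc0 : 0 < c' := lt_of_le_of_lt (le_max_right _ _) hc'
  have hC6 : C ≤ 6 * c' := by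
    have := lt_of_le_of_lt (le_max_left _ _) hc'
    linarith
  obtain ⟨D₁, h413⟩ := eq413_of_pos hc0
  obtain ⟨D₂, h412⟩ := hC
  refine ⟨max (max D₁ D₂) 2, fun D _ χ hD hq hp x hx ρ hρ hAρ w hw => ?_⟩
  have hD1 : D₁ ≤ D := le_trans (le_trans (le_max_left _ _) (le_max_left _ _)) hD
  have hD2' : D₂ ≤ D := le_trans (le_trans (le_max_right _ _) (le_max_left _ _)) hD
  have hD2 : 2 ≤ D := le_trans (le_max_right _ _) hD
  have hα := alpha_pos hD2
  have hδ0 : 0 < c' * alpha D * ell D := mul_pos (mul_pos hc0 hα) (ell_pos hD2)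
  have hw2 : ‖w‖ < 2 * alpha D := by rw [hw]; nlinarith
  have e412 := h412 D χ hD2' hq hp x hx ρ hρ hAρ w hw2
  have e413 := h413 D χ hD1 hq hp w hw
  have hη0 : 0 ≤ alpha D * ell D := alpha_mul_ell_nonneg D
  calc ‖calA χ x (1 / 2 + ρ.im * I + w) - (1 - Pm2w D w)‖ ≤ C * (alpha D * ell D) := e412
    _ ≤ 6 * c' * (alpha D * ell D) := mul_le_mul_of_nonneg_right hC6 hη0
    _ = 6 * c' * alpha D * ell D := by ring
    _ < ‖1 - Pm2w D w‖ := e413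


/-- Membership in `Ω` (2.7) spelled out: `|σ − 1/2| < 1/2`, `|t − 2πt₀| < 𝓛₁ + 2`.
[cite: Zhang2022LandauSiegel, §2 (2.7) p.6] -/
private theorem mem_Omega_iff' (D : ℕ) (s : ℂ) :
    s ∈ Omega D ↔ |s.re - 1 / 2| < 1 / 2 ∧ |s.im - 2 * π * t0 D| < ell1 D + 2 := by
  have hre : (s - s0 D).re = s.re - 1 / 2 := by simp [s0, SmoothWeight.s0, sub_re]
  have him : (s - s0 D).im = s.im - 2 * π * t0 D := by simp [s0, SmoothWeight.s0, sub_im]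
  simp only [Omega, Set.mem_setOf_eq, hre, him]

/-- **Proposition 2.2 (i) from Lemmas 4.5, 4.6 AS STATED plus the proof's Case 2 at the seam**
(kernel EDGE; the manuscript's "Lemma 4.5 and 4.6 together imply the assertions (i) and (ii)",
p.23, for (i)): a zero `s` of `L(s,ψ)L(s,ψχ)` in `Ω` is a zero of `𝒜 = L·L/F`; if `σ ≥ 1/2` then
`σ < 1/2 + α²` forces `σ = 1/2` (Lemma 4.6), `1/2 + α² ≤ σ < 1/2 + 𝓛⁻¹` is excluded by Case 2's
"`|𝒜(s,ψ)| ≫ α`" (`Step4u046Alpha` — this covers the seam point `σ = 1/2 + α²` that the two lemma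
STATEMENTS omit), and `1/2 + 𝓛⁻¹ ≤ σ < 1` by Lemma 4.5 (`𝓛⁻¹ > α²`); if `σ < 1/2`, the reflected zero
`1 − s̄ ∈ Ω` (`LLZeroReflect`) has real part `1 − σ > 1/2`, impossible by the same trichotomy. No use
of Lemma 4.2 is needed for (i). [cite: Zhang2022LandauSiegel, §4 p.23; Prop. 2.2 (i) p.6] -/
theorem prop22i_of (c' : ℝ) (hrefl : LLZeroReflect) (h45 : Lemma45) (h46a : Step4u046Alpha)
    (h46 : Lemma46 c') : Prop22i := by
  obtain ⟨D₁, h45'⟩ := h45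
  obtain ⟨c, hc, D₂, h46a'⟩ := h46a
  obtain ⟨D₃, h46'⟩ := h46
  refine ⟨max (max D₁ D₂) (max D₃ 8), fun D _ χ hD hq hp x hx s hs => ?_⟩
  have hD1 : D₁ ≤ D := le_trans (le_trans (le_max_left _ _) (le_max_left _ _)) hD
  have hD2 : D₂ ≤ D := le_trans (le_trans (le_max_right _ _) (le_max_left _ _)) hD
  have hD3 : D₃ ≤ D := le_trans (le_trans (le_max_left _ _) (le_max_right _ _)) hD
  have hD8 : 8 ≤ D := le_trans (le_trans (le_max_right _ _) (le_max_right _ _)) hD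
  have hDtwo : 2 ≤ D := le_trans (by norm_num) hD8
  have hDthree : 3 ≤ D := le_trans (by norm_num) hD8
  have hℓ2 : 2 ≤ ell D := two_le_ell_of_eight_le hD8
  have hα : 0 < alpha D := alpha_pos hDtwo
  have h4 := four_alpha_le_inv_ell hDtwo hℓ2
  have hinv : (ell D)⁻¹ ≤ 1 / 2 := by
    rw [inv_eq_one_div]; exact div_le_div_of_nonneg_left (by norm_num) (by norm_num) hℓ2
  have hα2 : alpha D ^ 2 < (ell D)⁻¹ := by nlinarith
  -- trichotomy for zeros with `σ ≥ 1/2`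
  have key : ∀ s' : ℂ, s' ∈ Omega D → LL χ x s' = 0 → 1 / 2 ≤ s'.re → s'.re = 1 / 2 := by
    intro s' hΩ hz hge
    have hA : calA χ x s' = 0 := by rw [calA, hz, zero_div]
    obtain ⟨h1, h2⟩ := (mem_Omega_iff' D s').mp hΩ
    obtain ⟨_, h1b⟩ := abs_lt.mp h1
    rcases lt_or_ge s'.re (1 / 2 + alpha D ^ 2) with hlt | hge2
    · exact (h46' D χ hD3 hq hp x hx s' hA hge hlt h2).1
    · exfalso
      rcases lt_or_ge s'.re (1 / 2 + (ell D)⁻¹) with hlt2 | hge3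
      · have h := h46a' D χ hD2 hq hp x hx s' ⟨hge2, hlt2, h2⟩
        rw [hA, norm_zero] at h
        nlinarith
      · exact h45' D χ hD1 hq hp x hx s' (by linarith) (by linarith) h2 hA
  obtain ⟨hΩ, hz⟩ := hs
  rcases le_or_gt (1 / 2) s.re with hge | hlt
  · exact key s hΩ hz hge
  · -- reflect a zero with `σ < 1/2`
    obtain ⟨h1, h2⟩ := (mem_Omega_iff' D s).mp hΩ
    obtain ⟨h1a, _⟩ := abs_lt.mp h1
    have hpos : 0 < s.re := by linarith
    have hz' : LL χ x (1 - conj s) = 0 := hrefl D χ x hDthree hq hp s hpos hz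
    have hre' : (1 - conj s).re = 1 - s.re := by simp
    have him' : (1 - conj s).im = s.im := by simp
    have hΩ' : (1 - conj s) ∈ Omega D := by
      rw [mem_Omega_iff', hre', him']
      refine ⟨?_, h2⟩
      rw [abs_lt]; constructor <;> linarith
    have h := key (1 - conj s) hΩ' hz' (by rw [hre']; linarith)
    rw [hre'] at h
    linarith


/-- **The gap remark from Proposition 2.2 (i) and Lemma 4.6** (kernel EDGE): if the zeros of
`L(s,ψ)L(s,ψχ)` in `Ω` lie on the line (`Prop22i`, e.g. by `prop22i_of`) and Lemma 4.6 holds with a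
constant `c″`, then for every LARGER `c′ > c″` the zeros are pairwise `> α(1−c′α𝓛)` apart
(Lemma 4.6 at `ρ = s` excludes zeros in the punctured disc `0 < |w| < α(1−c″α𝓛)`, and
`α(1−c′α𝓛) < α(1−c″α𝓛)`): the printed strict "`>`" costs an arbitrarily small increase of the
"sufficiently large" `c′`. [cite: Zhang2022LandauSiegel, §4 p.23] -/
theorem lem46Gap_of {c'' c' : ℝ} (hcc : c'' < c') (hi : Prop22i) (h46 : Lemma46 c'') :
    Lem46Gap c' := by
  obtain ⟨D₁, hi'⟩ := hi
  obtain ⟨D₂, h46'⟩ := h46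
  refine ⟨max (max D₁ D₂) 2, fun D _ χ hD hq hp x hx s hs s' hs' hne => ?_⟩
  have hD1 : D₁ ≤ D := le_trans (le_trans (le_max_left _ _) (le_max_left _ _)) hD
  have hD2 : D₂ ≤ D := le_trans (le_trans (le_max_right _ _) (le_max_left _ _)) hD
  have hDtwo : 2 ≤ D := le_trans (le_max_right _ _) hD
  have hα : 0 < alpha D := alpha_pos hDtwo
  have hℓ : 0 < ell D := ell_pos hDtwo
  have hre : s.re = 1 / 2 := hi' D χ hD1 hq hp x hx s hs
  obtain ⟨hΩ, hz⟩ := hs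
  obtain ⟨_, hz'⟩ := hs'
  obtain ⟨_, h2⟩ := (mem_Omega_iff' D s).mp hΩ
  have hA : calA χ x s = 0 := by rw [calA]; exact div_eq_zero_iff.mpr (Or.inl hz)
  have hA' : calA χ x s' = 0 := by rw [calA]; exact div_eq_zero_iff.mpr (Or.inl hz')
  have h := (h46' D χ hD2 hq hp x hx s hA (by rw [hre]) (by rw [hre]; nlinarith) h2).2.2 (s' - s)
  have hpos : 0 < ‖s' - s‖ := norm_pos_iff.mpr (sub_ne_zero.mpr (Ne.symm hne))
  have hge : alpha D * (1 - c'' * alpha D * ell D) ≤ ‖s' - s‖ := by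
    by_contra hlt
    push Not at hlt
    exact h hpos hlt (by rw [add_sub_cancel]; exact hA')
  have hlt : alpha D * (1 - c' * alpha D * ell D) < alpha D * (1 - c'' * alpha D * ell D) := by
    have : 0 < alpha D * alpha D * ell D := by positivity
    nlinarith
  rw [norm_sub_rev] at hge
  exact lt_of_lt_of_le hlt hge


/-- The Dirichlet polynomial `F(s,ψ) = Σ_{n≤D⁴} ν(n)ψ(n)n^{−s}` is entire. [cite: Zhang2022LandauSiegel, §3 p.12] -/
theorem differentiable_Fpoly {D : ℕ} [NeZero D] (χ : DirichletCharacter ℂ D) (x : Chr D) :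
    Differentiable ℂ (Fpoly χ x) := by
  unfold Fpoly
  apply Differentiable.fun_sum
  intro n hn
  have hn0 : (n : ℂ) ≠ 0 := by
    have : 1 ≤ n := (Finset.mem_Icc.mp hn).1
    exact_mod_cast (by omega : n ≠ 0)
  exact ((differentiable_id.neg).const_cpow (Or.inl hn0)).const_mul _

/-- **Proposition 2.2 (ii) from (i), Lemma 4.6 and Lemma 4.2** (kernel EDGE; the (ii) half of
"Lemma 4.5 and 4.6 together imply the assertions (i) and (ii)", p.23): a zero `s ∈ Ω` of
`L(s,ψ)L(s,ψχ)` lies on the line by (i), hence in Lemma 4.6's range, so `𝒜′(s,ψ) ≠ 0`; since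
`𝒜 = L·L/F` with `F(s,ψ) ≠ 0` (Lemma 4.2, `s ∈ Ω₁`) and `L·L(s) = 0`, `(L·L)′(s) = 𝒜′(s)F(s) ≠ 0`.
[cite: Zhang2022LandauSiegel, §4 p.23; Prop. 2.2 (ii) p.6] -/
theorem prop22ii_of (c' : ℝ) (h42 : Lemma42) (hi : Prop22i) (h46 : Lemma46 c') : Prop22ii := by
  obtain ⟨D₁, hF⟩ := fpoly_ne_zero_of_lemma42 h42
  obtain ⟨D₂, hi'⟩ := hi
  obtain ⟨D₃, h46'⟩ := h46
  refine ⟨max (max D₁ D₂) (max D₃ 8), fun D _ χ hD hq hp x hx s hs => ?_⟩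
  have hD1 : D₁ ≤ D := le_trans (le_trans (le_max_left _ _) (le_max_left _ _)) hD
  have hD2 : D₂ ≤ D := le_trans (le_trans (le_max_right _ _) (le_max_left _ _)) hD
  have hD3 : D₃ ≤ D := le_trans (le_trans (le_max_left _ _) (le_max_right _ _)) hD
  have hD8 : 8 ≤ D := le_trans (le_trans (le_max_right _ _) (le_max_right _ _)) hD
  have hDtwo : 2 ≤ D := le_trans (by norm_num) hD8
  have hDthree : 3 ≤ D := le_trans (by norm_num) hD8
  have hℓ2 : 2 ≤ ell D := two_le_ell_of_eight_le hD8
  have hα : 0 < alpha D := alpha_pos hDtwo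
  have hre : s.re = 1 / 2 := hi' D χ hD2 hq hp x hx s hs
  obtain ⟨hΩ, hz⟩ := hs
  have hz' : LL χ x s = 0 := hz
  obtain ⟨_, h2⟩ := (mem_Omega_iff' D s).mp hΩ
  have hreg : s ∈ lemma46Region D := ⟨by rw [hre], by rw [hre]; nlinarith, h2⟩
  have hΩ1 : s ∈ Omega1 D := mem_Omega1_of_mem_lemma46Region hDtwo hℓ2 hreg
  have hFs : Fpoly χ x s ≠ 0 := hF D χ hD1 hq hp x hx s hΩ1
  have hA : calA χ x s = 0 := by rw [calA, hz', zero_div]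
  have hdA : deriv (calA χ x) s ≠ 0 :=
    (h46' D χ hD3 hq hp x hx s hA (by rw [hre]) (by rw [hre]; nlinarith) h2).2.1
  -- `𝒜 = L·L / F`, differentiable pieces
  have hDp : D * x.p ≠ 1 :=
    (lt_of_lt_of_le (by omega : 1 < D) (Nat.le_mul_of_pos_right D x.prime.pos)).ne'
  have hpc1 : psiChi χ x ≠ 1 :=
    GammaFactor.ne_one_of_isPrimitive (psiChiPrimitive_holds D χ x hDthree hp) hDp
  have hLLd : DifferentiableAt ℂ (LL χ x) s := by
    have h1 := x.ψ.differentiableAt_LFunction s (Or.inr x.ψ_ne_one)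
    have h2 := (psiChi χ x).differentiableAt_LFunction s (Or.inr hpc1)
    exact h1.mul h2
  have hFd : DifferentiableAt ℂ (Fpoly χ x) s := differentiable_Fpoly χ x s
  have hcalA : calA χ x = LL χ x / Fpoly χ x := by funext w; rfl
  rw [hcalA, deriv_div hLLd hFd hFs, hz', zero_mul, sub_zero] at hdA
  intro hd0
  apply hdA
  have hd0' : deriv (LL χ x) s = 0 := hd0
  rw [hd0', zero_mul, zero_div]


/-- **`DedProp22i_ii c′` HOLDS GIVEN the Case-2 claim `Step4u046Alpha`** (kernel EDGE): the printed
"Lemma 4.5 and 4.6 together imply the assertions (i) and (ii) of Proposition 2.2" goes through once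
the seam `σ = 1/2 + α²` (omitted by both lemma STATEMENTS) is covered — and the printed proof of
Lemma 4.5, Case 2 ("`1/2 + α² ≤ σ < 1/2 + 𝓛⁻¹`", closed) covers it; so the deduction node is
discharged modulo that one proof-internal display (`prop22i_of`, `prop22ii_of`).
[cite: Zhang2022LandauSiegel, §4 p.23] -/
theorem dedProp22i_ii_of_step4u046Alpha (c' : ℝ) (h : Step4u046Alpha) : DedProp22i_ii c' :=
  fun h42 hrefl h45 h46 =>
    ⟨prop22i_of c' hrefl h45 h h46, prop22ii_of c' h42 (prop22i_of c' hrefl h45 h h46) h46⟩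


/-! ### "`|ℬ(1/2+it,ψ)| = 1`" from Lemma 4.2 (the tree's `Lemma45.norm_calB_half_eq_one`) -/

/-- `F(s,ψ)` is the tree's Dirichlet polynomial `A(ν;s,ψ)` over `n < D⁴ + 1` (`Lemma81.dirPoly`; the
`n = 0` term vanishes for `s ≠ 0`). [cite: Zhang2022LandauSiegel, §3 p.12] -/
theorem Fpoly_eq_dirPoly {D : ℕ} [NeZero D] (χ : DirichletCharacter ℂ D) (x : Chr D) {s : ℂ}
    (hs : s ≠ 0) : Fpoly χ x s = Lemma81.dirPoly (D ^ 4 + 1) (nu χ) x.ψ s := by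
  rw [Lemma81.dirPoly_def, Nat.range_succ_eq_Icc_zero,
    ← Finset.insert_Icc_add_one_left_eq_Icc (Nat.zero_le _), Finset.sum_insert (by simp), Fpoly]
  simp [Complex.zero_cpow (neg_ne_zero.mpr hs)]

/-- `conj ψ(n) = ψ̄(n) = ψ⁻¹(n)` for a Dirichlet character. [folklore] -/
private theorem conj_apply_eq_inv_apply {k : ℕ} (ψ : DirichletCharacter ℂ k) (n : ZMod k) :
    conj (ψ n) = ψ⁻¹ n := by
  rw [← MulChar.star_apply']
  rfl

/-- `F(s,ψ̄)` is `A(ν;s,ψ⁻¹)` over `n < D⁴ + 1` (`s ≠ 0`). [cite: Zhang2022LandauSiegel, Lemma 4.4 p.19] -/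
theorem FpolyBar_eq_dirPoly {D : ℕ} [NeZero D] (χ : DirichletCharacter ℂ D) (x : Chr D) {s : ℂ}
    (hs : s ≠ 0) : FpolyBar χ x s = Lemma81.dirPoly (D ^ 4 + 1) (nu χ) x.ψ⁻¹ s := by
  rw [Lemma81.dirPoly_def, Nat.range_succ_eq_Icc_zero,
    ← Finset.insert_Icc_add_one_left_eq_Icc (Nat.zero_le _), Finset.sum_insert (by simp), FpolyBar]
  simp [Complex.zero_cpow (neg_ne_zero.mpr hs), conj_apply_eq_inv_apply]

/-- `2πt₀ − 𝓛₁ − 2 > 0` (`t₀ = 𝓛⁵¹⁹`, `𝓛₁ = 𝓛⁴⁰⁵`, `𝓛 ≥ 1`): the window `|t − 2πt₀| < 𝓛₁ + 2` lies in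
`t > 0`. [cite: Zhang2022LandauSiegel, §2 (2.8) p.6] -/
private theorem pos_of_window {D : ℕ} (hℓ : 1 ≤ ell D) {t : ℝ} (ht : |t - 2 * π * t0 D| < ell1 D + 2) :
    0 < t := by
  obtain ⟨h1, _⟩ := abs_lt.mp ht
  have h405 : 1 ≤ ell D ^ 405 := one_le_pow₀ hℓ
  have h519 : ell D ^ 405 ≤ ell D ^ 519 := pow_le_pow_right₀ hℓ (by norm_num)
  rw [t0, ell1] at *
  nlinarith [Real.pi_gt_three]

/-- **`CalBNormOnLine` from Lemma 4.2** (kernel EDGE): "Since `|ℬ(1/2+it,ψ)| = 1`" holds for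
`ψ ∈ Ψ₁`, `|t − 2πt₀| < 𝓛₁ + 2`, `D` large — `|Z̃(1/2+it)| = 1` (`ψ`, `ψχ` primitive, `t > 0`),
`F(1/2−it,ψ̄) = conj F(1/2+it,ψ)` (`ν` real for quadratic `χ`), and `F(1/2+it,ψ) ≠ 0` by Lemma 4.2
(`1/2 + it ∈ Ω₁`); the tree's `Lemma45.norm_calB_half_eq_one`.
[cite: Zhang2022LandauSiegel, Lemma 4.5 (proof, Case 2) p.22] -/
theorem calBNormOnLine_of_lemma42 (h42 : Lemma42) : CalBNormOnLine := by
  obtain ⟨D₁, hF⟩ := fpoly_ne_zero_of_lemma42 h42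
  refine ⟨max D₁ 8, fun D _ χ hD hq hp x hx t ht => ?_⟩
  have hD1 : D₁ ≤ D := le_trans (le_max_left _ _) hD
  have hD8 : 8 ≤ D := le_trans (le_max_right _ _) hD
  have hDtwo : 2 ≤ D := le_trans (by norm_num) hD8
  have hDthree : 3 ≤ D := le_trans (by norm_num) hD8
  have hℓ2 : 2 ≤ ell D := two_le_ell_of_eight_le hD8
  have hα : 0 < alpha D := alpha_pos hDtwo
  have ht0 : 0 < t := pos_of_window (by linarith) ht
  have hsre : ((1 : ℂ) / 2 + t * I).re = 1 / 2 := by simp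
  have hs0 : (1 : ℂ) / 2 + t * I ≠ 0 := fun h => by
    have := congrArg Complex.re h; rw [hsre] at this; norm_num at this
  have h1s : 1 - ((1 : ℂ) / 2 + t * I) ≠ 0 := fun h => by
    have := congrArg Complex.re h; simp at this; norm_num at this
  have hreg : ((1 : ℂ) / 2 + t * I) ∈ lemma46Region D :=
    ⟨by rw [hsre], by rw [hsre]; nlinarith, by simpa using ht⟩
  have hΩ1 := mem_Omega1_of_mem_lemma46Region hDtwo hℓ2 hreg
  have hFs : Fpoly χ x (1 / 2 + t * I) ≠ 0 := hF D χ hD1 hq hp x hx _ hΩ1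
  have hν : ∀ n, conj (nu χ n) = nu χ n := fun n =>
    Complex.conj_eq_iff_im.mpr (Lemma31.divisorSumChar_im_eq_zero χ hq.sq_eq_one n)
  have hpc : (psiChi χ x).IsPrimitive := psiChiPrimitive_holds D χ x hDthree hp
  have hF' : Lemma81.dirPoly (D ^ 4 + 1) (nu χ) x.ψ (1 / 2 + t * I) ≠ 0 := by
    rwa [← Fpoly_eq_dirPoly χ x hs0]
  have key := Lemma45.norm_calB_half_eq_one (θ₂ := psiChi χ x) x.prim hpc (D ^ 4 + 1) hν ht0 hF'
  rw [calB, tildeZW, FpolyBar_eq_dirPoly χ x h1s, Fpoly_eq_dirPoly χ x hs0]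
  exact key


/-! ### (4.11), first line, from Lemma 4.2 (the tree's `Lemma45.logDeriv_calB`) -/

/-- `F(s,ψ̄)` is entire. [cite: Zhang2022LandauSiegel, Lemma 4.4 p.19] -/
theorem differentiable_FpolyBar {D : ℕ} [NeZero D] (χ : DirichletCharacter ℂ D) (x : Chr D) :
    Differentiable ℂ (FpolyBar χ x) := by
  unfold FpolyBar
  apply Differentiable.fun_sum
  intro n hn
  have hn0 : (n : ℂ) ≠ 0 := by
    have : 1 ≤ n := (Finset.mem_Icc.mp hn).1
    exact_mod_cast (by omega : n ≠ 0)
  exact ((differentiable_id.neg).const_cpow (Or.inl hn0)).const_mul _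

/-- `conj (n^{−s}) = n^{−s̄}` for a natural number `n`. [folklore] -/
private theorem conj_natCast_cpow_neg (n : ℕ) (s : ℂ) :
    conj ((n : ℂ) ^ (-s)) = (n : ℂ) ^ (-conj s) := by
  have h := Complex.conj_cpow (n : ℂ) (-conj s)
    (by rw [Complex.natCast_arg]; exact Real.pi_pos.ne)
  rw [Complex.conj_natCast, map_neg, Complex.conj_conj] at h
  exact h.symm

/-- **`F(s,ψ̄) = conj F(s̄,ψ)`** (the coefficients `ν(n)` are real for the real character `χ`).
[cite: Zhang2022LandauSiegel, Lemma 4.4 p.19] -/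
theorem FpolyBar_eq_conj {D : ℕ} [NeZero D] {χ : DirichletCharacter ℂ D} (hq : χ.IsQuadratic)
    (x : Chr D) (z : ℂ) : FpolyBar χ x z = conj (Fpoly χ x (conj z)) := by
  unfold FpolyBar Fpoly
  rw [map_sum]
  refine Finset.sum_congr rfl fun n _ => ?_
  have hν : conj (nu χ n) = nu χ n :=
    Complex.conj_eq_iff_im.mpr (Lemma31.divisorSumChar_im_eq_zero χ hq.sq_eq_one n)
  rw [map_mul, map_mul, hν, conj_natCast_cpow_neg, Complex.conj_conj]

/-- `𝓛 ≥ M` once `D ≥ ⌈exp M⌉₊` (any real `M`). [cite: Zhang2022LandauSiegel, §2 (2.1) p.3] -/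
private theorem le_ell_of_ceil_exp_le_loc {M : ℝ} {D : ℕ} (hD : ⌈Real.exp M⌉₊ ≤ D) : M ≤ ell D := by
  have hDexp : Real.exp M ≤ D := le_trans (Nat.le_ceil _) (by exact_mod_cast hD)
  have hDpos : (0 : ℝ) < D := lt_of_lt_of_le (Real.exp_pos _) hDexp
  rw [ell]; exact (Real.le_log_iff_exp_le hDpos).mpr hDexp

/-- For `log 𝓛 ≥ 100`, `𝓛⁻¹ ≤ log𝓛/(100𝓛)`, so `Ω₂`'s σ-range `(1/2 − 𝓛⁻¹, 1 + 𝓛⁻¹)` lies inside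
`Ω₁`'s — the manuscript's tacit `Ω₂ ⊂ Ω₁` ("`D` sufficiently large": `D ≥ exp(e¹⁰⁰)`).
[cite: Zhang2022LandauSiegel, Lemma 4.3 (proof) p.17] -/
private theorem inv_ell_le_log_div {D : ℕ} (hℓ : Real.exp 100 ≤ ell D) :
    (ell D)⁻¹ ≤ Real.log (ell D) / (100 * ell D) := by
  have hℓ0 : 0 < ell D := lt_of_lt_of_le (Real.exp_pos _) hℓ
  have hlog : 100 ≤ Real.log (ell D) := (Real.le_log_iff_exp_le hℓ0).mpr hℓ
  rw [inv_eq_one_div, div_le_div_iff₀ hℓ0 (by positivity)]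
  nlinarith

/-- **(4.11), first line, from Lemma 4.2** (kernel EDGE `Lemma42 → Eq411Identity`): at
`w = σ′ + it` (`1/2 ≤ σ′ ≤ σ < 1/2 + 𝓛⁻¹`, `|t − 2πt₀| < 𝓛₁ + 2`, so `t > 0`) the three factors of
`ℬ = Z̃·F(1−·,ψ̄)/F` are differentiable and non-zero: `Z̃ = Z(·,ψ)Z(·,ψχ)` on `Im > 0` (tree
`GammaFactor.differentiableAt_Zfac`, `Zfac_ne_zero`, both characters primitive), `F(w,ψ) ≠ 0` and
`F(1−w,ψ̄) = conj F(1−w̄,ψ) ≠ 0` by Lemma 4.2, since `w` and `1 − w̄` lie in `Ω₁` — the latter once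
`𝓛⁻¹ ≤ log𝓛/(100𝓛)`, i.e. `D ≥ exp(e¹⁰⁰)` ("sufficiently large"); then the tree's
`Lemma45.logDeriv_calB`. [cite: Zhang2022LandauSiegel, (4.11) p.21] -/
theorem eq411Identity_of_lemma42 (h42 : Lemma42) : Eq411Identity := by
  obtain ⟨D₁, hF⟩ := fpoly_ne_zero_of_lemma42 h42
  refine ⟨max (max D₁ 8) ⌈Real.exp (Real.exp 100)⌉₊, fun D _ χ hD hq hp x hx s hs σ' h1 h2 => ?_⟩
  have hD1 : D₁ ≤ D := le_trans (le_trans (le_max_left _ _) (le_max_left _ _)) hD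
  have hD8 : 8 ≤ D := le_trans (le_trans (le_max_right _ _) (le_max_left _ _)) hD
  have hDtwo : 2 ≤ D := le_trans (by norm_num) hD8
  have hDthree : 3 ≤ D := le_trans (by norm_num) hD8
  have hℓ2 : 2 ≤ ell D := two_le_ell_of_eight_le hD8
  have hℓ0 : 0 < ell D := ell_pos hDtwo
  have hℓbig : Real.exp 100 ≤ ell D := le_ell_of_ceil_exp_le_loc (le_trans (le_max_right _ _) hD)
  have hinvlog := inv_ell_le_log_div hℓbig
  have hlogpos : 0 < Real.log (ell D) / (100 * ell D) :=
    div_pos (Real.log_pos (by linarith)) (by positivity)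
  obtain ⟨hσα, hσ, ht⟩ := hs
  have ht0 : 0 < s.im := pos_of_window (by linarith) ht
  set w : ℂ := (σ' : ℂ) + s.im * I with hw
  have hwre : w.re = σ' := by simp [hw]
  have hwim : w.im = s.im := by simp [hw]
  -- the three factors
  have hpc : (psiChi χ x).IsPrimitive := psiChiPrimitive_holds D χ x hDthree hp
  have hZd : DifferentiableAt ℂ (tildeZW χ x) w :=
    (GammaFactor.differentiableAt_Zfac x.ψ (by rw [hwim]; exact ht0)).mul
      (GammaFactor.differentiableAt_Zfac (psiChi χ x) (by rw [hwim]; exact ht0))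
  have hZ0 : tildeZW χ x w ≠ 0 :=
    mul_ne_zero (GammaFactor.Zfac_ne_zero x.prim (by rw [hwim]; exact ht0))
      (GammaFactor.Zfac_ne_zero hpc (by rw [hwim]; exact ht0))
  have hwΩ1 : w ∈ Omega1 D := by
    simp only [Omega1, Lemma43.mem_Omega1_iff, hwre, hwim]
    exact ⟨by linarith, by linarith, by linarith⟩
  have hF0 : Fpoly χ x w ≠ 0 := hF D χ hD1 hq hp x hx w hwΩ1
  -- the mirror point `1 − w̄ ∈ Ω₁` (this is where `log 𝓛 ≥ 100` enters)
  have hmirror : (1 - conj w) ∈ Omega1 D := by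
    have hre : (1 - conj w).re = 1 - σ' := by simp [hw]
    have him : (1 - conj w).im = s.im := by simp [hw]
    simp only [Omega1, Lemma43.mem_Omega1_iff, hre, him]
    refine ⟨by linarith, by linarith, by linarith⟩
  have hFb0 : FpolyBar χ x (1 - w) ≠ 0 := by
    rw [FpolyBar_eq_conj hq, map_sub, map_one]
    exact (map_ne_zero _).mpr (hF D χ hD1 hq hp x hx _ hmirror)
  have hFd : DifferentiableAt ℂ (Fpoly χ x) w := differentiable_Fpoly χ x w
  have hFbd : DifferentiableAt ℂ (FpolyBar χ x) (1 - w) := differentiable_FpolyBar χ x (1 - w)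
  have key := Lemma45.logDeriv_calB (Z := tildeZW χ x) (Fb := FpolyBar χ x) (F := Fpoly χ x)
    hZ0 hFb0 hF0 hZd hFbd hFd
  have hcalB : calB χ x = fun z => tildeZW χ x z * FpolyBar χ x (1 - z) / Fpoly χ x z := by
    funext z; rfl
  simp only [logDeriv_apply] at key
  rw [hcalB]
  exact key


/-! ### Lemma 4.5, Case 2: `u045 ⇒ u046 ⇒ "≫ α"` (the tree's `Lemma45.norm_calA_ge*`) -/

/-- **`Z22:§4.u046` (first part) from (4.10) and `Z22:§4.u045`** (kernel EDGE): on Case 2's range,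
`|𝒜(s)| ≥ 1 − |ℬ(s)| − C𝓛⁻¹⁰⁰` ((4.10), `s ∈ Ω₃`) and `|ℬ(s)| = e^{log|ℬ(s)|} < P^{1/2−σ}`.
[cite: Zhang2022LandauSiegel, Lemma 4.5 (proof, Case 2) p.22] -/
theorem step4u046_of (h410 : Eq410) (h45 : Step4u045) : Step4u046 := by
  obtain ⟨C, hA⟩ := h410
  obtain ⟨D₀, hall⟩ := hA.and h45
  refine ⟨C, max D₀ 8, fun D _ χ hD hq hp x hx s hs => ?_⟩
  have hD₀ : D₀ ≤ D := le_trans (le_max_left _ _) hD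
  have hD8 : 8 ≤ D := le_trans (le_max_right _ _) hD
  have hDtwo : 2 ≤ D := le_trans (by norm_num) hD8
  have hℓ2 : 2 ≤ ell D := two_le_ell_of_eight_le hD8
  have hα : 0 < alpha D := alpha_pos hDtwo
  have h4 := four_alpha_le_inv_ell hDtwo hℓ2
  have hinv : (ell D)⁻¹ ≤ 1 / 2 := by
    rw [inv_eq_one_div]; exact div_le_div_of_nonneg_left (by norm_num) (by norm_num) hℓ2
  obtain ⟨hA', h45'⟩ := hall D χ hD₀ hq hp
  obtain ⟨hσα, hσ, ht⟩ := hs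
  have hΩ3 : s ∈ Omega3 D := ⟨by nlinarith, by linarith, by linarith⟩
  have e410 := hA' x hx s hΩ3
  have e45 := h45' x hx s ⟨hσα, hσ, ht⟩
  have hB : ‖calB χ x s‖ < bigP D ^ (1 / 2 - s.re) := by
    by_cases h0 : calB χ x s = 0
    · rw [h0, norm_zero]; exact Real.rpow_pos_of_pos (bigP_pos D) _
    · have hpos : 0 < ‖calB χ x s‖ := norm_pos_iff.mpr h0
      calc ‖calB χ x s‖ = Real.exp (Real.log ‖calB χ x s‖) := (Real.exp_log hpos).symm
        _ < Real.exp ((1 / 2 - s.re) * Real.log (bigP D)) := Real.exp_lt_exp.mpr e45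
        _ = bigP D ^ (1 / 2 - s.re) := by rw [Real.rpow_def_of_pos (bigP_pos D), mul_comm]
  have h1 := Lemma45.norm_calA_ge e410 (le_refl ‖calB χ x s‖)
  linarith

/-- `log P = 𝓛⁹`. [cite: Zhang2022LandauSiegel, §2 (2.6) p.5] -/
private theorem log_bigP' (D : ℕ) : Real.log (bigP D) = ell D ^ 9 := by
  rw [bigP, Real.log_exp]

/-- **`Z22:§4.u046` "≫ α" from its first part** (kernel EDGE, constant `c = 1`): for
`σ ≥ 1/2 + α²`, `P^{1/2−σ} ≤ P^{−α²} = e^{−πα}`, `1 − e^{−πα} ≥ πα/2` (`πα ≤ 1`), and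
`C𝓛⁻¹⁰⁰ ≤ 𝓛⁻⁹ ≤ (π/2 − 1)πα⁻¹·α…` precisely `C𝓛⁻¹⁰⁰ ≤ (π/2−1)α` once `𝓛 ≥ |C| + 1`; so
`|𝒜(s)| > πα/2 − C𝓛⁻¹⁰⁰ ≥ α` (the tree's `Lemma45.rpow_le_exp_neg_pi_alpha`).
[cite: Zhang2022LandauSiegel, Lemma 4.5 (proof, Case 2) p.22] -/
theorem step4u046Alpha_of (h : Step4u046) : Step4u046Alpha := by
  obtain ⟨C, D₀, hC⟩ := h
  refine ⟨1, one_pos, max D₀ (max 8 ⌈Real.exp (|C| + 1)⌉₊), fun D _ χ hD hq hp x hx s hs => ?_⟩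
  have hD₀ : D₀ ≤ D := le_trans (le_max_left _ _) hD
  have hD8 : 8 ≤ D := le_trans (le_trans (le_max_left _ _) (le_max_right _ _)) hD
  have hℓC : |C| + 1 ≤ ell D :=
    le_ell_of_ceil_exp_le_loc (le_trans (le_trans (le_max_right _ _) (le_max_right _ _)) hD)
  have hDtwo : 2 ≤ D := le_trans (by norm_num) hD8
  have hℓ2 : 2 ≤ ell D := two_le_ell_of_eight_le hD8
  have hℓ1 : 1 ≤ ell D := by linarith
  have hℓ0 : 0 < ell D := by linarith
  have hα : 0 < alpha D := alpha_pos hDtwo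
  obtain ⟨hσα, hσ, ht⟩ := hs
  have e := hC D χ hD₀ hq hp x hx s ⟨hσα, hσ, ht⟩
  -- `P^{1/2−σ} ≤ e^{−πα}`
  have e1 : bigP D ^ (1 / 2 - s.re) ≤ Real.exp (-(π * alpha D)) :=
    Lemma45.rpow_le_exp_neg_pi_alpha (one_lt_bigP hDtwo) hσα
  -- `πα ≤ 1` and `1 − e^{−x} ≥ x/2` for `0 ≤ x ≤ 1`
  have hαeq : alpha D = π / ell D ^ 9 := Section2.alpha_eq_pi_div_ell9 D
  have h9 : (512 : ℝ) ≤ ell D ^ 9 := by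
    calc (512 : ℝ) = 2 ^ 9 := by norm_num
      _ ≤ ell D ^ 9 := pow_le_pow_left₀ (by norm_num) hℓ2 9
  have hx1 : π * alpha D ≤ 1 := by
    rw [hαeq, mul_div_assoc', div_le_one (by positivity)]
    have hππ : π * π < 16 := by nlinarith [Real.pi_lt_four, Real.pi_pos]
    linarith
  have hx0 : 0 ≤ π * alpha D := by positivity
  have h3 : π * alpha D / 2 ≤ 1 - Real.exp (-(π * alpha D)) := by
    set y : ℝ := π * alpha D with hy
    have h5 : Real.exp (-y) ≤ 1 / (1 + y) := by
      rw [Real.exp_neg, one_div]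
      exact inv_anti₀ (by linarith) (by linarith [Real.add_one_le_exp y])
    have h6 : y / (1 + y) = 1 - 1 / (1 + y) := by field_simp; ring
    have h7 : y / 2 ≤ y / (1 + y) := by
      rw [div_le_div_iff₀ (by norm_num) (by linarith)]; nlinarith
    linarith
  -- `C𝓛⁻¹⁰⁰ ≤ (π/2 − 1)α`
  have hCE : C * (ell D ^ 100)⁻¹ ≤ (π / 2 - 1) * alpha D := by
    have i1 : C * (ell D ^ 100)⁻¹ ≤ |C| * (ell D ^ 100)⁻¹ :=
      mul_le_mul_of_nonneg_right (le_abs_self C) (by positivity)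
    have i2 : (ell D ^ 100)⁻¹ ≤ (ell D ^ 10)⁻¹ :=
      inv_anti₀ (by positivity) (pow_le_pow_right₀ hℓ1 (by norm_num))
    have i3 : |C| * (ell D ^ 10)⁻¹ ≤ (ell D ^ 9)⁻¹ := by
      rw [show ell D ^ 10 = ell D ^ 9 * ell D by ring, mul_inv, ← mul_comm (ell D)⁻¹, ← mul_assoc]
      have : |C| * (ell D)⁻¹ ≤ 1 := by
        rw [← div_eq_mul_inv, div_le_one hℓ0]; linarith
      exact mul_le_of_le_one_left (by positivity) this
    have i4 : (ell D ^ 9)⁻¹ ≤ (π / 2 - 1) * alpha D := by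
      rw [hαeq, ← mul_div_assoc, inv_eq_one_div, div_le_div_iff_of_pos_right (by positivity)]
      nlinarith [Real.pi_gt_three]
    have i5 : |C| * (ell D ^ 100)⁻¹ ≤ |C| * (ell D ^ 10)⁻¹ :=
      mul_le_mul_of_nonneg_left i2 (abs_nonneg C)
    linarith
  linarith


/-! ### Lemma 4.5, Case 2: `u045` from Lemma 4.2 and (4.11) (the tree's `Lemma45.log_norm_*`) -/

/-- **Regularity of `ℬ` on Case 2's horizontal segments, from Lemma 4.2**: for `D` large (incl.
`log 𝓛 ≥ 100`), `ψ ∈ Ψ₁`, `s = σ + it` in Case 2's range and `1/2 ≤ σ′ ≤ σ`, the function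
`ℬ = Z̃·F(1−·,ψ̄)/F` is analytic and non-zero at `σ′ + it` (`Z̃` analytic, zero-free on `Im > 0`;
`F`, `F(·,ψ̄)` entire; `F(σ′+it) ≠ 0` and `F(1−σ′−it,ψ̄) = conj F(1−σ′+it,ψ) ≠ 0` by Lemma 4.2 on `Ω₁`).
[cite: Zhang2022LandauSiegel, Lemma 4.5 (proof, Case 2) p.21] -/
theorem calB_analytic_ne_zero_of_lemma42 (h42 : Lemma42) :
    ForAllLarge fun D _ χ => ∀ x ∈ PsiOne χ, ∀ s ∈ case2Region45 D,
      ∀ σ' : ℝ, 1 / 2 ≤ σ' → σ' ≤ s.re →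
        AnalyticAt ℂ (calB χ x) ((σ' : ℂ) + s.im * I) ∧ calB χ x ((σ' : ℂ) + s.im * I) ≠ 0 := by
  obtain ⟨D₁, hF⟩ := fpoly_ne_zero_of_lemma42 h42
  refine ⟨max (max D₁ 8) ⌈Real.exp (Real.exp 100)⌉₊, fun D _ χ hD hq hp x hx s hs σ' h1 h2 => ?_⟩
  have hD1 : D₁ ≤ D := le_trans (le_trans (le_max_left _ _) (le_max_left _ _)) hD
  have hD8 : 8 ≤ D := le_trans (le_trans (le_max_right _ _) (le_max_left _ _)) hD
  have hDtwo : 2 ≤ D := le_trans (by norm_num) hD8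
  have hDthree : 3 ≤ D := le_trans (by norm_num) hD8
  have hℓ2 : 2 ≤ ell D := two_le_ell_of_eight_le hD8
  have hℓ0 : 0 < ell D := ell_pos hDtwo
  have hℓbig : Real.exp 100 ≤ ell D := le_ell_of_ceil_exp_le_loc (le_trans (le_max_right _ _) hD)
  have hinvlog := inv_ell_le_log_div hℓbig
  have hlogpos : 0 < Real.log (ell D) / (100 * ell D) :=
    div_pos (Real.log_pos (by linarith)) (by positivity)
  obtain ⟨hσα, hσ, ht⟩ := hs
  have ht0 : 0 < s.im := pos_of_window (by linarith) ht
  set w : ℂ := (σ' : ℂ) + s.im * I with hw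
  have hwre : w.re = σ' := by simp [hw]
  have hwim : w.im = s.im := by simp [hw]
  have him : 0 < w.im := by rw [hwim]; exact ht0
  have hpc : (psiChi χ x).IsPrimitive := psiChiPrimitive_holds D χ x hDthree hp
  have hZa : AnalyticAt ℂ (tildeZW χ x) w :=
    (GammaFactor.analyticAt_Zfac x.ψ him).mul (GammaFactor.analyticAt_Zfac (psiChi χ x) him)
  have hZ0 : tildeZW χ x w ≠ 0 :=
    mul_ne_zero (GammaFactor.Zfac_ne_zero x.prim him) (GammaFactor.Zfac_ne_zero hpc him)
  have hwΩ1 : w ∈ Omega1 D := by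
    simp only [Omega1, Lemma43.mem_Omega1_iff, hwre, hwim]
    exact ⟨by linarith, by linarith, by linarith⟩
  have hF0 : Fpoly χ x w ≠ 0 := hF D χ hD1 hq hp x hx w hwΩ1
  have hmirror : (1 - conj w) ∈ Omega1 D := by
    have hre : (1 - conj w).re = 1 - σ' := by simp [hw]
    have him' : (1 - conj w).im = s.im := by simp [hw]
    simp only [Omega1, Lemma43.mem_Omega1_iff, hre, him']
    refine ⟨by linarith, by linarith, by linarith⟩
  have hFb0 : FpolyBar χ x (1 - w) ≠ 0 := by
    rw [FpolyBar_eq_conj hq, map_sub, map_one]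
    exact (map_ne_zero _).mpr (hF D χ hD1 hq hp x hx _ hmirror)
  have hFa : AnalyticAt ℂ (Fpoly χ x) w := (differentiable_Fpoly χ x).analyticAt w
  have hFba : AnalyticAt ℂ (fun z => FpolyBar χ x (1 - z)) w :=
    ((differentiable_FpolyBar χ x).comp ((differentiable_const 1).sub differentiable_id)).analyticAt w
  have hcalB : calB χ x = fun z => tildeZW χ x z * FpolyBar χ x (1 - z) / Fpoly χ x z := by
    funext z; rfl
  rw [hcalB]
  exact ⟨(hZa.mul hFba).div hFa hF0, div_ne_zero (mul_ne_zero hZ0 hFb0) hF0⟩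

/-- `s = σ + it` rebuilt from its parts inside `ℬ`. [folklore] -/
private theorem calB_re_add_im {D : ℕ} [NeZero D] (χ : DirichletCharacter ℂ D) (x : Chr D)
    (s : ℂ) : calB χ x ((s.re : ℂ) + s.im * I) = calB χ x s := by
  rw [Complex.re_add_im]

/-- **Display `Z22:§4.u045`, the identity, from Lemma 4.2** (kernel EDGE `Lemma42 → Step4u045Eq`):
`ℬ` is analytic and zero-free on the segment `[1/2, σ] + it` and `|ℬ(1/2+it)| = 1`
(`calBNormOnLine_of_lemma42`), so `log|ℬ(s)| = Re∫_{1/2}^{σ} ℬ′/ℬ(σ′+it)dσ′` (the tree's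
`Lemma45.log_norm_eq_re_integral`). [cite: Zhang2022LandauSiegel, Lemma 4.5 (proof, Case 2) p.22] -/
theorem step4u045Eq_of_lemma42 (h42 : Lemma42) : Step4u045Eq := by
  obtain ⟨D₁, hreg⟩ := calB_analytic_ne_zero_of_lemma42 h42
  obtain ⟨D₂, hone⟩ := calBNormOnLine_of_lemma42 h42
  refine ⟨max (max D₁ D₂) 2, fun D _ χ hD hq hp x hx s hs => ?_⟩
  have hD1 : D₁ ≤ D := le_trans (le_trans (le_max_left _ _) (le_max_left _ _)) hD
  have hD2 : D₂ ≤ D := le_trans (le_trans (le_max_right _ _) (le_max_left _ _)) hD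
  have hDtwo : 2 ≤ D := le_trans (le_max_right _ _) hD
  have hα : 0 < alpha D := alpha_pos hDtwo
  obtain ⟨hσα, hσ, ht⟩ := hs
  have hreg' := hreg D χ hD1 hq hp x hx s ⟨hσα, hσ, ht⟩
  have hhalf : (1 : ℝ) / 2 ≤ s.re := by nlinarith
  have h1 : ‖calB χ x ((((1 : ℝ) / 2 : ℝ) : ℂ) + s.im * I)‖ = 1 := by
    have := hone D χ hD2 hq hp x hx s.im ht
    push_cast
    exact this
  have key := Lemma45.log_norm_eq_re_integral (h := calB χ x) (t := s.im) hhalf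
    (fun σ' hσ' => (hreg' σ' hσ'.1 hσ'.2).1) (fun σ' hσ' => (hreg' σ' hσ'.1 hσ'.2).2) h1
  rw [calB_re_add_im] at key
  exact key

/-- **Display `Z22:§4.u045`, the inequality, from Lemma 4.2 and (4.11)** (kernel EDGE
`Lemma42 → Eq411 → Step4u045`): `Re ℬ′/ℬ ≤ −2log P + C𝓛 =: −K` on the segment, so
`log|ℬ(s)| ≤ −K(σ − 1/2) < (1/2 − σ)log P` since `σ > 1/2` and `K > log P = 𝓛⁹` once `𝓛⁸ > C`
(the tree's `Lemma45.log_norm_le_of_re_logDeriv_le`). [cite: Zhang2022LandauSiegel, Lemma 4.5 (proof, Case 2) p.22] -/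
theorem step4u045_of (h42 : Lemma42) (h411 : Eq411) : Step4u045 := by
  obtain ⟨D₁, hreg⟩ := calB_analytic_ne_zero_of_lemma42 h42
  obtain ⟨D₂, hone⟩ := calBNormOnLine_of_lemma42 h42
  obtain ⟨C, D₃, hC⟩ := h411
  refine ⟨max (max D₁ D₂) (max D₃ (max 8 ⌈Real.exp (|C| + 1)⌉₊)),
    fun D _ χ hD hq hp x hx s hs => ?_⟩
  have hD1 : D₁ ≤ D := le_trans (le_trans (le_max_left _ _) (le_max_left _ _)) hD
  have hD2 : D₂ ≤ D := le_trans (le_trans (le_max_right _ _) (le_max_left _ _)) hD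
  have hD3 : D₃ ≤ D := le_trans (le_trans (le_max_left _ _) (le_max_right _ _)) hD
  have hD8 : 8 ≤ D :=
    le_trans (le_trans (le_trans (le_max_left _ _) (le_max_right _ _)) (le_max_right _ _)) hD
  have hℓC : |C| + 1 ≤ ell D := le_ell_of_ceil_exp_le_loc
    (le_trans (le_trans (le_trans (le_max_right _ _) (le_max_right _ _)) (le_max_right _ _)) hD)
  have hDtwo : 2 ≤ D := le_trans (by norm_num) hD8
  have hℓ2 : 2 ≤ ell D := two_le_ell_of_eight_le hD8
  have hℓ1 : 1 ≤ ell D := by linarith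
  have hα : 0 < alpha D := alpha_pos hDtwo
  obtain ⟨hσα, hσ, ht⟩ := hs
  have hreg' := hreg D χ hD1 hq hp x hx s ⟨hσα, hσ, ht⟩
  have hC' := hC D χ hD3 hq hp x hx s ⟨hσα, hσ, ht⟩
  have hhalf : (1 : ℝ) / 2 ≤ s.re := by nlinarith
  have h1 : ‖calB χ x ((((1 : ℝ) / 2 : ℝ) : ℂ) + s.im * I)‖ = 1 := by
    have := hone D χ hD2 hq hp x hx s.im ht
    push_cast
    exact this
  set K : ℝ := 2 * Real.log (bigP D) - C * ell D with hK
  have hKbound : ∀ σ' ∈ Set.Icc (1 / 2 : ℝ) s.re,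
      (deriv (calB χ x) ((σ' : ℂ) + s.im * I) / calB χ x ((σ' : ℂ) + s.im * I)).re ≤ -K := by
    intro σ' hσ'
    have hq' := hC' σ' hσ'.1 hσ'.2
    have hre := Complex.re_le_norm (deriv (calB χ x) ((σ' : ℂ) + s.im * I) /
      calB χ x ((σ' : ℂ) + s.im * I) + 2 * Real.log (bigP D))
    have hre2 : (deriv (calB χ x) ((σ' : ℂ) + s.im * I) / calB χ x ((σ' : ℂ) + s.im * I)
        + 2 * Real.log (bigP D)).re
        = (deriv (calB χ x) ((σ' : ℂ) + s.im * I) / calB χ x ((σ' : ℂ) + s.im * I)).re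
          + 2 * Real.log (bigP D) := by
      simp
    rw [hK]
    linarith
  have key := Lemma45.log_norm_le_of_re_logDeriv_le (h := calB χ x) (t := s.im) hhalf
    (fun σ' hσ' => (hreg' σ' hσ'.1 hσ'.2).1) (fun σ' hσ' => (hreg' σ' hσ'.1 hσ'.2).2) h1 hKbound
  rw [calB_re_add_im] at key
  -- `−K(σ − 1/2) < (1/2 − σ)log P`: `K > log P` since `𝓛⁸ > C`
  have hlogP : Real.log (bigP D) = ell D ^ 9 := log_bigP' D
  have hσpos : 1 / 2 < s.re := by nlinarith
  have hKgt : Real.log (bigP D) < K := by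
    rw [hK, hlogP]
    have h8 : ell D ≤ ell D ^ 8 := le_self_pow₀ hℓ1 (by norm_num)
    have hC8 : C < ell D ^ 8 := by linarith [le_abs_self C]
    have : C * ell D < ell D ^ 9 := by
      calc C * ell D < ell D ^ 8 * ell D := mul_lt_mul_of_pos_right hC8 (by linarith)
        _ = ell D ^ 9 := by ring
    linarith
  calc Real.log ‖calB χ x s‖ ≤ -K * (s.re - 1 / 2) := key
    _ < (1 / 2 - s.re) * Real.log (bigP D) := by nlinarith


/-! ### (4.11) from Lemma 4.2, Lemma 4.3 and (4.6) ("Hence, by Lemma 4.3 and (4.6)") -/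

/-- **(4.11) from Lemma 4.2, Lemma 4.3 and (4.6)** (kernel EDGE
`Lemma42 → Lemma43 → Section4.Eq46 → Eq411`, the manuscript's "Hence, by Lemma 4.3 and (4.6)"):
at `w = σ′+it`, `ℬ′/ℬ = Z̃′/Z̃ − F′/F(w) − F̄′/F̄(1−w)` (`eq411Identity_of_lemma42`), with
`|Z̃′/Z̃ + 2log P| ≤ C₆𝓛` ((4.6) = L1-t3's `Section4.Eq46`, `w ∈` its region `|Re(w−s₀)| < 100`,
`|Im(w−s₀)| < 𝓛₁+3`), `|F′/F(w)| ≤ C₃𝓛` and `|F̄′/F̄(1−w)| = |F′/F(1−w̄)| ≤ C₃𝓛` (Lemma 4.3 at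
`w, 1−w̄ ∈ Ω₂`, `lem45Case2MemOmega2_holds`; `F(·,ψ̄) = conj∘F(·,ψ)∘conj`, Mathlib
`deriv_conj_conj`). Constant `C₆ + 2C₃`. [cite: Zhang2022LandauSiegel, (4.11) p.21] -/
theorem eq411_of (h42 : Lemma42) (h43 : Lemma43) (h46 : Eq46) : Eq411 := by
  obtain ⟨D₁, hId⟩ := eq411Identity_of_lemma42 h42
  obtain ⟨C₃, D₂, h43'⟩ := h43
  obtain ⟨C₆, D₃, h46'⟩ := h46
  obtain ⟨D₄, hmem⟩ := lem45Case2MemOmega2_holds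
  refine ⟨C₆ + C₃ + C₃, max (max D₁ D₂) (max D₃ (max D₄ 8)),
    fun D _ χ hD hq hp x hx s hs σ' h1 h2 => ?_⟩
  have hD1 : D₁ ≤ D := le_trans (le_trans (le_max_left _ _) (le_max_left _ _)) hD
  have hD2 : D₂ ≤ D := le_trans (le_trans (le_max_right _ _) (le_max_left _ _)) hD
  have hD3 : D₃ ≤ D := le_trans (le_trans (le_max_left _ _) (le_max_right _ _)) hD
  have hD4 : D₄ ≤ D :=
    le_trans (le_trans (le_trans (le_max_left _ _) (le_max_right _ _)) (le_max_right _ _)) hD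
  have hD8 : 8 ≤ D :=
    le_trans (le_trans (le_trans (le_max_right _ _) (le_max_right _ _)) (le_max_right _ _)) hD
  have hDtwo : 2 ≤ D := le_trans (by norm_num) hD8
  have hℓ2 : 2 ≤ ell D := two_le_ell_of_eight_le hD8
  have hα : 0 < alpha D := alpha_pos hDtwo
  have h4 := four_alpha_le_inv_ell hDtwo hℓ2
  have hinv : (ell D)⁻¹ ≤ 1 / 2 := by
    rw [inv_eq_one_div]; exact div_le_div_of_nonneg_left (by norm_num) (by norm_num) hℓ2
  have eId := hId D χ hD1 hq hp x hx s hs σ' h1 h2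
  obtain ⟨hwΩ2, hmirΩ2⟩ := hmem D χ hD4 hq hp s hs σ' h1 h2
  obtain ⟨hσα, hσ, ht⟩ := hs
  set w : ℂ := (σ' : ℂ) + s.im * I with hw
  have e43a := h43' D χ hD2 hq hp x hx w hwΩ2
  have e43b := h43' D χ hD2 hq hp x hx (1 - conj w) hmirΩ2
  have hwR : w ∈ Region45 D := by
    have hre : (w - s0 D).re = σ' - 1 / 2 := by simp [hw, s0, SmoothWeight.s0]
    have him : (w - s0 D).im = s.im - 2 * π * t0 D := by simp [hw, s0, SmoothWeight.s0]
    simp only [Region45, Set.mem_setOf_eq, hre, him]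
    refine ⟨?_, by linarith⟩
    rw [abs_lt]; constructor <;> linarith
  have e46 := h46' D χ hD3 hq hp x w hwR
  -- `F̄′/F̄(1 − w) = conj (F′/F(1 − w̄))`
  have hfun : FpolyBar χ x = conj ∘ Fpoly χ x ∘ conj := funext fun z => FpolyBar_eq_conj hq x z
  have hFb : deriv (FpolyBar χ x) (1 - w) / FpolyBar χ x (1 - w)
      = conj (deriv (Fpoly χ x) (1 - conj w) / Fpoly χ x (1 - conj w)) := by
    rw [hfun, deriv_conj_conj]
    simp [map_div₀]
  rw [eId, hFb]
  set X := deriv (tildeZW χ x) w / tildeZW χ x w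
  set Y := deriv (Fpoly χ x) w / Fpoly χ x w
  set V := deriv (Fpoly χ x) (1 - conj w) / Fpoly χ x (1 - conj w)
  have hV : ‖conj V‖ = ‖V‖ := Complex.norm_conj V
  have hsplit : X - Y - conj V + 2 * (Real.log (bigP D) : ℂ) = (X + 2 * Real.log (bigP D)) - Y - conj V := by
    ring
  rw [hsplit]
  calc ‖X + 2 * (Real.log (bigP D) : ℂ) - Y - conj V‖
      ≤ ‖X + 2 * (Real.log (bigP D) : ℂ) - Y‖ + ‖conj V‖ := norm_sub_le _ _
    _ ≤ ‖X + 2 * (Real.log (bigP D) : ℂ)‖ + ‖Y‖ + ‖conj V‖ := by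
        gcongr; exact norm_sub_le _ _
    _ ≤ C₆ * ell D + C₃ * ell D + C₃ * ell D := by rw [hV]; gcongr
    _ = (C₆ + C₃ + C₃) * ell D := by ring

/-- **Lemma 4.5 from Lemma 4.2, (4.10), (4.11) and Case 1's `ℬ ≪ P^{1/2−σ}`** (kernel EDGE, the
whole printed proof of Lemma 4.5 assembled: `dedLem45_holds`, `step4u046Alpha_of`, `step4u046_of`,
`step4u045_of`). [cite: Zhang2022LandauSiegel, Lemma 4.5 (proof) pp.21–22] -/
theorem lemma45_of (h42 : Lemma42) (h410 : Eq410) (h411 : Eq411) (h44 : Step4u044) : Lemma45 :=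
  dedLem45_holds h410 h44 (step4u046Alpha_of (step4u046_of h410 (step4u045_of h42 h411)))

/-- The same with (4.11) replaced by its inputs Lemma 4.3 and (4.6): **Lemma 4.5 from Lemmas
4.2, 4.3, (4.6), (4.10) and Case 1's `Z22:§4.u044`**. [cite: Zhang2022LandauSiegel, Lemma 4.5 (proof) pp.21–22] -/
theorem lemma45_of' (h42 : Lemma42) (h43 : Lemma43) (h46 : Eq46) (h410 : Eq410)
    (h44 : Step4u044) : Lemma45 :=
  lemma45_of h42 h410 (eq411_of h42 h43 h46) h44

end Literature.NumberTheory.LFunctions.Zhang2022.Section4
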